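import Mathlib
import Literature.NumberTheory.LFunctions.Zhang2022.SkeletonPartTwo
import Literature.NumberTheory.LFunctions.Zhang2022.SkeletonReductions
import Literature.NumberTheory.LFunctions.Zhang2022.Section10MainTerms
import Literature.Analysis.Complex.RectangleCauchyDerivatives
import Literature.NumberTheory.LFunctions.Zhang2022.SkeletonAlpha1
import Literature.NumberTheory.LFunctions.Zhang2022.Section10Lemma101Tent
import HarnessLib

/-!
# Zhang (2022) §10a, typed statements: the head of §10, Lemma 10.1 and Lemma 10.2 with their
# proofs' displayed steps (tex L2690–L2867, PDF pp. 53–56)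

Topic `Literature/NumberTheory/LFunctions/Zhang2022` (Landau–Siegel audit tree; verdict-neutral).
Y. Zhang, *Discrete mean estimates and the Landau–Siegel zero*, arXiv:2211.02515v1 (2022)
[Zhang2022LandauSiegel] — **an unrefereed manuscript under adjudication. Every `def … : Prop`
below is a CLAIM OF THE MANUSCRIPT, STATED NOT ASSERTED; nothing here asserts or denies its
Theorems 1–2.** Cell siegel-zhang, D-0069 campaign, layer L3, slice L3-t1 = file
`TypedSection10A` of `plan/L3/ASSIGNMENTS.md` v1.1: the 42 DAG nodes `Z22:Prop2.4.pf … Z22:§10.u026`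
of `plan/DAG.tsv` (§10 "Proof of Proposition 2.4", first half). Statements first (D-0014): every
displayed claim is a named `Prop` over the banked skeleton objects (`Skeleton*`, cited by name, never
restated), every displayed definition is a `def` or a reference to the tree decl that already holds it,
and every proof block is a DEDUCTION node (the implication "displayed/cited inputs ⇒ statement").
The kernel-checked content of this file is limited to book-keeping EDGES between nodes and a few
elementary discharges (conjugation on the critical line; the residue of Lemma 10.1 via the tree's
`Section10MainTerms`).

Conventions (those of the skeleton, `SkeletonPropositions`): `ForAllLarge` = "for every real primitive
`χ (mod D)`, `D ≥ D₀`"; section-wide hypothesis (A) = `AssumptionA D χ →` (§5: "(A) assumed from here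
on") on every claim that mentions `χ` or `L`; "`X = M + O(𝓛⁻ᵏ)`" ↦ `∃ C, ForAllLarge … ‖X − M‖ ≤ C·𝓛⁻ᵏ`;
"`o(𝓛⁻ᵏ)`", "`o(𝔓)`" ↦ `∀ ε > 0, ForAllLarge … ≤ ε·(…)`; "`≪ T⁻ᶜ`" ↦ `∃ c > 0, ∃ C, … ≤ C·T⁻ᶜ`;
`1 ≤ j ≤ 3` ↦ `j ∈ {1,2,3}`; `(1/2πi)∫_{(c)} F(s)ds` ↦ `lineInt c F` (below); "the residue at `s = 0`"
of a function whose only singularity is at `0` ↦ its normalised integral over every circle `C(0,r)`;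
`xˢ` for real `x > 0` ↦ `((x : ℝ) : ℂ) ^ s`. `α₁` (never defined in v1; read1-12) is read as `α𝓛`
(skel/GAP-NODE-MAP). **Blanket (A)**: "Throughout the rest of this paper we assume that (A) holds. This
assumption will not be repeated in the statements" (tex L1559, p. 28) — so EVERY claim node below carries
`AssumptionA D χ →`, including the pure identities ((10.6), the reflections, the residues, the
`β`-arithmetic), whose kernel proofs here are nevertheless unconditional (`conj_J1_eq`, `residue101_eq`).

| DAG node | locator | decl here / tree decl cited | kind |
|---|---|---|---|
| Z22:Prop2.4.pf | §10, pp. 53–62 | `Prop24Proof c'`; EDGE `prop24Proof_of_ded1017` (from `Skeleton.Ded1017`, `prop24_of_eval1017`) | DEDUCTION |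
| Z22:§10.u001 | p. 53, tex L2695 | `J1Bar`, `Step10u001`; PROVED `step10u001_holds` | CLAIM (identity) |
| Z22:§10.u002 | p. 53, tex L2698 | `J2Bar`, `Step10u002`; PROVED `step10u002_holds` | CLAIM (identity) |
| Z22:§10.u003 | p. 53, tex L2702 | `Step10u003 c'`; EDGE `step10u003_of : Prop22i → Lemma81 → …` | CLAIM |
| Z22:§10.u004 | p. 53, tex L2706 | `Skeleton.a13` (SkeletonMeanValue, p403323) — cited | OBJECT (tree) |
| Z22:§10.u005 | p. 53, tex L2710 | `Step10u005 c'`; EDGE `step10u005_of` | CLAIM |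
| Z22:§10.u006 | p. 53, tex L2713 | `Skeleton.a14` (p403323) — cited | OBJECT (tree) |
| Z22:(10.1) | p. 53, tex L2716 | `Skeleton.Eq101` (p403323; EDGE `eq101_of` p404629); here EDGE `eq101_of_steps` ("Hence") | CLAIM (tree) |
| Z22:Lem10.1 | p. 53, tex L2723 | `Skeleton.Lemma101 c'` (p409333); bridge `lemma101_iff_eqs` | CLAIM (tree) |
| Z22:§10.u007 | p. 53, tex L2725 | `Skeleton.frakv1` (p409333) — cited | OBJECT (tree) |
| Z22:(10.2)–(10.4) | pp. 53–54, tex L2729–L2737 | `Eq102 c'`, `Eq103 c'`, `Eq104 c'` | CLAIM |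
| Z22:§10.u008 | p. 54, tex L2741 | `edgeWindows D` | OBJECT |
| Z22:(10.5) | p. 54, tex L2745 | `Eq105 c'` | CLAIM |
| Z22:Lem10.1.pf | pp. 54–55, tex L2751 | `Lemma101Proof c'` | DEDUCTION |
| Z22:§10.u009 | p. 54, tex L2753 | `Pp1`, `Pp2`, `Pp3` (`Pp1_eq_P1`) | OBJECT |
| Z22:(10.6) | p. 54, tex L2757 | `Eq106` (with `lineInt`) | CLAIM (identity) |
| Z22:(10.7) | p. 54, tex L2762 | `Eq107 c'` | CLAIM (identity) |
| Z22:§10.u010 | p. 54, tex L2767 | `Step10u010 c'` | CLAIM |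
| Z22:§10.u011 | p. 54, tex L2772 | `Step10u011 c'`; PROVED `step10u011_holds` (tree `lemma101_range2`) | CLAIM (residue) |
| Z22:§10.u012 | p. 54, tex L2778 | `Step10u012 c'` | CLAIM (identity) |
| Z22:§10.u013 | p. 54, tex L2785 | `Step10u013` | CLAIM |
| Z22:§10.u013 (α₁ := α log T reading of record) | p. 54, tex L2785 | `Step10u013R`; PROVED `step10u013R_holds`; edge `step10u013R_of_step10u013` | CLAIM (discharged) |
| Z22:Lem10.2 | p. 55, tex L2789 | `Skeleton.Lemma102 c'` (p409333); bridge `lemma102_iff_eqs` | CLAIM (tree) |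
| Z22:§10.u014 | p. 55, tex L2790 | `Skeleton.frakv2` — cited | OBJECT (tree) |
| Z22:(10.8)–(10.10) | p. 55, tex L2794–L2806 | `Eq108 c'`, `Eq109 c'`, `Eq1010 c'` | CLAIM |
| Z22:§10.u015, u016 | p. 55, tex L2802, L2810 | `Skeleton.fraky1`, `Skeleton.fraky2` — cited | OBJECT (tree) |
| Z22:§10.u017 | p. 55, tex L2814 | `edgeWindows D` at `y = dr` (same set as u008) | OBJECT |
| Z22:(10.11) | p. 55, tex L2817 | `Eq1011 c'` | CLAIM |
| Z22:Lem10.2.pf | pp. 55–56, tex L2823 | `Lemma102Proof c'` | DEDUCTION |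
| Z22:§10.u018 | p. 55, tex L2824 | `Step10u018 c'` | CLAIM (identity) |
| Z22:§10.u019 | p. 56, tex L2831 | `Step10u019 c'` | CLAIM |
| Z22:§10.u020 | p. 56, tex L2836 | `Step10u020` | CLAIM (removable singularity) |
| Z22:§10.u021 | p. 56, tex L2842 | `Step10u021 c'` (verbatim range) + `Step10u021r c'` ((10.9)'s range), EDGE `step10u021r_of` | CLAIM |
| Z22:§10.u022 | p. 56, tex L2847 | `Step10u022 c'` | CLAIM |
| Z22:§10.u023 | p. 56, tex L2857 | `Step10u023 c'` (NUM:pending, plan/L3 §4) | CLAIM |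
| Z22:§10.u024 | p. 56, tex L2860 | `Step10u024 c'` (tree `yy11 … yy23`) | CLAIM |
| Z22:§10.u025 | p. 56, tex L2864 | tree `Zhang2022.yy11` (Section10Defs); `yy11_eq_printed` | OBJECT (tree) |
| Z22:§10.u026 | p. 56, tex L2867 | tree `Zhang2022.yy21`; `yy21_eq_printed` | OBJECT (tree) |

Printed slips recorded, not silently repaired (each at its decl): "proof of lemma 8.1" (tex L2766,
L2830) describes the contour of the proof of Lemma 8.2; "The yields (11.3)" (L2771) means (10.3);
"by Lemma 5.8 and 8.2" (L2830) — `Π(d,r)` is Lemma 8.3's; the displays at L2824 and L2831 print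
`∫` where (10.6)/(10.7) and the two displays after them print `(1/2πi)∫` (typed WITH the factor, as
the value (10.8) they "yield" requires); "`𝔲₀ⱼ(s;d,r)`" (L2825) is Lemma 8.3's `𝔲ⱼ(d,r;1+s)`; the
range "`P^{0.5}/T < dr ≤ P^{0.502}`" (L2841) vs (10.9)'s "`P^{0.5} < dr ≤ P^{0.502}/T`" (both typed).
External input: the Pólya–Vinogradov inequality (L2751, L2786) = plan/FACT-LIST.md row **F-16**, kernel
handle `Literature.NumberTheory.LFunctions.norm_partialSum_le_polyaVinogradov` (a THEOREM of the tree, class T: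
apply it, no hypothesis binder). No new named facts: every `def … : Prop` here is a manuscript node.

## References

* Y. Zhang, arXiv:2211.02515v1 (2022), §10 pp. 53–56, (10.1)–(10.11), Lemmas 10.1–10.2; §8
  Lemmas 8.1–8.3, (8.9); §5 Lemma 5.8; §2 (2.28)–(2.30). [cite: Zhang2022LandauSiegel, §10]
-/

noncomputable section

open Complex Real ComplexConjugate Metric Set MeasureTheory

namespace Literature.NumberTheory.LFunctions.Zhang2022.Typed.Sec10A

open Literature.NumberTheory.LFunctions.Zhang2022.Skeleton

/-! ## Small utilities (re-proved locally; the skeleton's versions are `private`) -/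

/-- `log D ≥ 5` once `D ≥ ⌈e⁵⌉`. [folklore] -/
private theorem five_le_log {D : ℕ} (hD : ⌈Real.exp 5⌉₊ ≤ D) : 5 ≤ Real.log D := by
  have h : Real.exp 5 ≤ D := le_trans (Nat.le_ceil _) (by exact_mod_cast hD)
  exact (Real.le_log_iff_exp_le (lt_of_lt_of_le (Real.exp_pos _) h)).mpr h

/-- `conj (n^m) = n^{conj m}` for a natural number `n`. [folklore] -/
private theorem conj_natCast_cpow (n : ℕ) (m : ℂ) : conj ((n : ℂ) ^ m) = (n : ℂ) ^ conj m := by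
  have h := Complex.conj_cpow (n : ℂ) (conj m) (by rw [Complex.natCast_arg]; exact Real.pi_pos.ne)
  rw [Complex.conj_natCast, Complex.conj_conj] at h
  exact h.symm

/-- On the critical line `conj s = 1 − s`. [cite: Zhang2022LandauSiegel, §2 (2.12)] -/
private theorem conj_eq_one_sub {s : ℂ} (hs : s.re = 1 / 2) : conj s = 1 - s := by
  apply Complex.ext
  · simp [hs]; norm_num
  · simp

/-- A real (quadratic) character is fixed by complex conjugation. [folklore] -/
private theorem conj_apply_of_isQuadratic {D : ℕ} (χ : DirichletCharacter ℂ D)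
    (hq : χ.IsQuadratic) (a : ZMod D) : conj (χ a) = χ a := by
  rcases hq a with h | h | h <;> simp [h]

/-- The normalising constant of the standing error terms is non-negative: `0 ≤ (𝓛ᵏ)⁻¹`. [folklore] -/
private theorem ell_pow_inv_nonneg (D k : ℕ) : 0 ≤ (ell D ^ k)⁻¹ :=
  inv_nonneg.mpr (pow_nonneg (Real.log_natCast_nonneg D) k)

/-! ## The normalised vertical-line integral `(1/2πi)∫_{(c)}` -/

/-- **`(1/2πi)∫_{(c)} F(s) ds`**, the integral up the vertical line `Re s = c`
(`s = c + it`, `ds = i dt`): `(1/2π)∫_{−∞}^{∞} F(c + it) dt` (the tree's convention, cf.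
`Lemma81.segInt`). [cite: Zhang2022LandauSiegel, §10 (10.6)] -/
def lineInt (c : ℝ) (F : ℂ → ℂ) : ℂ := (1 / (2 * π) : ℂ) * ∫ t : ℝ, F ((c : ℂ) + (t : ℂ) * I)

/-! ## §10 head (p. 53): the reflections of `J₁, J₂`, the two "By Lemma 8.1" displays, (10.1) -/

section Head

variable (c' : ℝ) {D : ℕ} [NeZero D] (χ : DirichletCharacter ℂ D)

/-- **`J₁(w, ψ̄) = Σ_n χψ̄(n) n^{−w} f̃(log n/log P)`**: the polynomial `J₁` of (2.29) at the conjugate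
character `ψ̄` (the middle/right member of the display Z22:§10.u001, used at `w = 1 − s`; a finite
sum, `f̃` has compact support). [cite: Zhang2022LandauSiegel, §10 p. 53, tex L2695; §2 (2.29)] -/
def J1Bar (x : Chr D) (w : ℂ) : ℂ :=
  ∑ᶠ n : ℕ, χ (n : ZMod D) * conj (x.ψ (n : ZMod x.p)) * (n : ℂ) ^ (-w) *
    (ftilde (Real.log n / Real.log (bigP D)) : ℂ)

/-- **`J₂(w, ψ̄) = Σ_n χψ̄(n) n^{−w} f̃(log n/log P + 0.004 − α̃)`** (Z22:§10.u002 at `w = 1 − s`).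
[cite: Zhang2022LandauSiegel, §10 p. 53, tex L2698; §2 (2.30)] -/
def J2Bar (x : Chr D) (w : ℂ) : ℂ :=
  ∑ᶠ n : ℕ, χ (n : ZMod D) * conj (x.ψ (n : ZMod x.p)) * (n : ℂ) ^ (-w) *
    (ftilde (Real.log n / Real.log (bigP D) + 0.004 - alphaTilde D) : ℂ)

/-- **Z22:§10.u001** (p. 53, tex L2695): "Note that `f̃(z) ∈ ℝ`. If `σ = 1/2`, then
`conj J₁(s,ψ) = Σ_n χψ̄(n) n^{−(1−s)} f̃(log n/log P) = J₁(1−s,ψ̄)`" (for the real character `χ` and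
`ψ ∈ Ψ`; blanket (A)). CLAIM (an identity; PROVED below unconditionally, `conj_J1_eq`, `step10u001_holds`).
[cite: Zhang2022LandauSiegel, §10 p. 53, tex L2695] -/
def Step10u001 : Prop :=
  ForAllLarge fun D _ χ => AssumptionA D χ →
    ∀ x : Chr D, ∀ s : ℂ, s.re = 1 / 2 → conj (J1 χ x s) = J1Bar χ x (1 - s)

/-- **Z22:§10.u002** (p. 53, tex L2698): "`conj J₂(s,ψ) = Σ_n χψ̄(n) n^{−(1−s)} f̃(log n/log P + 0.004 − α̃)
= J₂(1−s,ψ̄)`" for `σ = 1/2` (blanket (A)). CLAIM (identity; PROVED below, `conj_J2_eq`, `step10u002_holds`).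
[cite: Zhang2022LandauSiegel, §10 p. 53, tex L2698] -/
def Step10u002 : Prop :=
  ForAllLarge fun D _ χ => AssumptionA D χ →
    ∀ x : Chr D, ∀ s : ℂ, s.re = 1 / 2 → conj (J2 χ x s) = J2Bar χ x (1 - s)

/-- **Z22:§10.u003** (p. 53, tex L2702): "By Lemma 8.1 we have
`Σ_{ψ∈Ψ₁}Σ_{ρ∈𝔷(ψ)} 𝔠*(ρ,ψ)H₁(ρ,ψ)conj J₁(ρ,ψ) ω(ρ) = Θ₁(𝐚₁₁,𝐚₁₃) + conj Θ₁(𝐚₁₃,𝐚₂₁) + o(𝔓)`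
with `a₁₁(n)`, `a₂₁(n)` given by (8.8), and with `a₁₃(n) = χ(n)f̃(log n/log P)`" (tree `Skeleton.a13`).
CLAIM; it FOLLOWS from Prop. 2.2 (i) and Lemma 8.1 (EDGE `step10u003_of`).
[cite: Zhang2022LandauSiegel, §10 p. 53, tex L2702] -/
def Step10u003 : Prop :=
  ∀ ε : ℝ, 0 < ε → ForAllLarge fun D _ χ => AssumptionA D χ →
    ‖(∑ i ∈ idx χ, cstar c' D i.1 i.2 * H1 χ i.1 i.2 * conj (J1 χ i.1 i.2) * omegaW D i.2) -
        (Theta1 c' χ (a11 χ) (a13 χ) + conj (Theta1 c' χ (a13 χ) (a21 χ)))‖ ≤ ε * frakP D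

/-- **Z22:§10.u005** (p. 53, tex L2710): "`Σ_{ψ∈Ψ₁}Σ_{ρ∈𝔷(ψ)} 𝔠*(ρ,ψ)conj H₂(ρ,ψ) J₂(ρ,ψ) ω(ρ)
= Θ₁(𝐚₁₄,𝐚₂₂) + conj Θ₁(𝐚₁₂,𝐚₁₄) + o(𝔓)` with `a₁₂(n)`, `a₂₂(n)` given by (9.2), and with
`a₁₄(n) = χ(n)f̃(log n/log P + 0.004 − α̃)`" (tree `Skeleton.a14`). CLAIM; EDGE `step10u005_of`.
[cite: Zhang2022LandauSiegel, §10 p. 53, tex L2710] -/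
def Step10u005 : Prop :=
  ∀ ε : ℝ, 0 < ε → ForAllLarge fun D _ χ => AssumptionA D χ →
    ‖(∑ i ∈ idx χ, cstar c' D i.1 i.2 * conj (H2 χ i.1 i.2) * J2 χ i.1 i.2 * omegaW D i.2) -
        (Theta1 c' χ (a14 χ) (a22 χ) + conj (Theta1 c' χ (a12 χ) (a14 χ)))‖ ≤ ε * frakP D

/-- **Z22:Prop2.4.pf** — "§10. Proof of Proposition 2.4" (pp. 53–62) as ONE deduction node: the
section derives Proposition 2.4 (`Skeleton.Prop24 c'`, "`|Ξ₁*| > 5𝔞𝔓`") from (10.1), Proposition 7.1,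
Lemmas 8.2–8.4 ("the results in Section 8"), Lemmas 10.1–10.2, the computations (10.12)–(10.17) and
the numerical step `|𝔡′ + 𝔡| > 5` (tree `Prop24Main`, certified `Prop24Main_holds`). Typed as the
implication from the named inputs; it FOLLOWS from the skeleton's finer node `Ded1017` ((10.12)–(10.17))
by the banked edge `prop24_of_eval1017` — `prop24Proof_of_ded1017`. CLAIM (deduction).
[cite: Zhang2022LandauSiegel, §10 pp. 53–62, tex L2690] -/
def Prop24Proof : Prop :=
  Eq101 c' → Prop71 c' → Lemma82 c' → Lemma83 c' → Lemma84 c' → Lemma101 c' → Lemma102 c' →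
    Prop24 c'

end Head

/-! ## Lemma 10.1 (pp. 53–54): the four ranges (10.2)–(10.5) as separate nodes -/

section Lemma101Nodes

variable (c' : ℝ)

/-- **(10.2)** (Z22:(10.2), p. 53, tex L2729; `𝔳₁ⱼ(y)` = `Skeleton.frakv1`): "If `1 ≤ y ≤ P^{0.5}/T`,
then `𝔳₁ⱼ(y) ≪ T⁻ᶜ`" (`1 ≤ j ≤ 3`, some absolute `c > 0`). CLAIM (first clause of `Skeleton.Lemma101`).
[cite: Zhang2022LandauSiegel, §10 (10.2), p. 53] -/
def Eq102 : Prop :=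
  ∃ c : ℝ, 0 < c ∧ ∃ C : ℝ, ForAllLarge fun D _ χ => AssumptionA D χ →
    ∀ j ∈ ({1, 2, 3} : Finset ℕ), ∀ y : ℝ, 1 ≤ y → y ≤ bigP D ^ (0.5 : ℝ) / bigT D →
      ‖frakv1 c' χ j y‖ ≤ C * bigT D ^ (-c)

/-- **(10.3)** (Z22:(10.3), p. 53, tex L2733): "if `P^{0.5} < y ≤ P^{0.502}/T`, then
`𝔳₁ⱼ(y) = (500L′(1,χ)/log P)(−1 − β_j log(y/P^{0.5})) + O(𝓛⁻¹⁵)`". CLAIM.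
[cite: Zhang2022LandauSiegel, §10 (10.3), p. 53] -/
def Eq103 : Prop :=
  ∃ C : ℝ, ForAllLarge fun D _ χ => AssumptionA D χ →
    ∀ j ∈ ({1, 2, 3} : Finset ℕ), ∀ y : ℝ,
      bigP D ^ (0.5 : ℝ) < y → y ≤ bigP D ^ (0.502 : ℝ) / bigT D →
        ‖frakv1 c' χ j y - 500 * deriv χ.LFunction 1 / Real.log (bigP D) *
          (-1 - betaJ c' D j * (Real.log (y / bigP D ^ (0.5 : ℝ)) : ℂ))‖ ≤ C * (ell D ^ 15)⁻¹

/-- **(10.4)** (Z22:(10.4), p. 54, tex L2737): "if `P^{0.502} < y ≤ P^{0.504}/T`, then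
`𝔳₁ⱼ(y) = (500L′(1,χ)/log P)(1 − β_j log(P^{0.504}/y)) + O(𝓛⁻¹⁵)`". CLAIM.
[cite: Zhang2022LandauSiegel, §10 (10.4), p. 54] -/
def Eq104 : Prop :=
  ∃ C : ℝ, ForAllLarge fun D _ χ => AssumptionA D χ →
    ∀ j ∈ ({1, 2, 3} : Finset ℕ), ∀ y : ℝ,
      bigP D ^ (0.502 : ℝ) < y → y ≤ bigP D ^ (0.504 : ℝ) / bigT D →
        ‖frakv1 c' χ j y - 500 * deriv χ.LFunction 1 / Real.log (bigP D) *
          (1 - betaJ c' D j * (Real.log (bigP D ^ (0.504 : ℝ) / y) : ℂ))‖ ≤ C * (ell D ^ 15)⁻¹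

/-- **Z22:§10.u008** (p. 54, tex L2741; also Z22:§10.u017, p. 55, tex L2814, with `y = dr`): the three
"edge windows" `y ∈ (P^{0.5}/T, P^{0.5}] ∪ (P^{0.502}/T, P^{0.502}] ∪ (P^{0.504}/T, P^{0.504})`
(half-open, half-open, open — as printed). [cite: Zhang2022LandauSiegel, §10 (10.5), p. 54, tex L2741] -/
def edgeWindows (D : ℕ) : Set ℝ :=
  Set.Ioc (bigP D ^ (0.5 : ℝ) / bigT D) (bigP D ^ (0.5 : ℝ)) ∪
    Set.Ioc (bigP D ^ (0.502 : ℝ) / bigT D) (bigP D ^ (0.502 : ℝ)) ∪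
    Set.Ioo (bigP D ^ (0.504 : ℝ) / bigT D) (bigP D ^ (0.504 : ℝ))

/-- Membership in the edge windows, spelled out as the disjunction used by `Skeleton.Lemma101/102`.
[cite: Zhang2022LandauSiegel, §10 (10.5), p. 54] -/
theorem mem_edgeWindows_iff (D : ℕ) (y : ℝ) :
    y ∈ edgeWindows D ↔
      (bigP D ^ (0.5 : ℝ) / bigT D < y ∧ y ≤ bigP D ^ (0.5 : ℝ)) ∨
        (bigP D ^ (0.502 : ℝ) / bigT D < y ∧ y ≤ bigP D ^ (0.502 : ℝ)) ∨
        (bigP D ^ (0.504 : ℝ) / bigT D < y ∧ y < bigP D ^ (0.504 : ℝ)) := by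
  simp only [edgeWindows, Set.mem_union, Set.mem_Ioc, Set.mem_Ioo, or_assoc]

/-- **(10.5)** (Z22:(10.5), p. 54, tex L2745): "if `y ∈ (P^{0.5}/T, P^{0.5}] ∪ (P^{0.502}/T, P^{0.502}]
∪ (P^{0.504}/T, P^{0.504})`, then `𝔳₁ⱼ(y) ≪ 𝓛⁻⁷`". CLAIM.
[cite: Zhang2022LandauSiegel, §10 (10.5), p. 54] -/
def Eq105 : Prop :=
  ∃ C : ℝ, ForAllLarge fun D _ χ => AssumptionA D χ →
    ∀ j ∈ ({1, 2, 3} : Finset ℕ), ∀ y ∈ edgeWindows D, ‖frakv1 c' χ j y‖ ≤ C * (ell D ^ 7)⁻¹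

end Lemma101Nodes

/-! ## Proof of Lemma 10.1 (pp. 54–55): `P′₁, P′₂, P′₃`, (10.6), (10.7) and the displayed steps -/

section Lemma101Proof

variable (c' : ℝ)

/-- **`P′₁ = P^{0.504}`** (Z22:§10.u009, p. 54, tex L2753; the same number as `P₁` of (2.21),
`Pp1_eq_P1`). [cite: Zhang2022LandauSiegel, §10 p. 54, tex L2753] -/
def Pp1 (D : ℕ) : ℝ := bigP D ^ (0.504 : ℝ)

/-- **`P′₂ = P^{0.502}`** (Z22:§10.u009). [cite: Zhang2022LandauSiegel, §10 p. 54, tex L2753] -/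
def Pp2 (D : ℕ) : ℝ := bigP D ^ (0.502 : ℝ)

/-- **`P′₃ = P^{0.5}`** (Z22:§10.u009). [cite: Zhang2022LandauSiegel, §10 p. 54, tex L2753] -/
def Pp3 (D : ℕ) : ℝ := bigP D ^ (0.5 : ℝ)

/-- `P′₁ = P₁` ((2.21): `P₁ = P^{0.504}`). [cite: Zhang2022LandauSiegel, §2 (2.21); §10 p. 54] -/
theorem Pp1_eq_P1 (D : ℕ) : Pp1 D = Skeleton.P1 D := rfl

/-- **(10.6)** (Z22:(10.6), p. 54, tex L2757): "`f̃(log y/log P) = (500/log P)·(1/2πi)∫_{(1)}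
((P′₁)ˢ − 2(P′₂)ˢ + (P′₃)ˢ) y⁻ˢ ds/s²`" (for `y > 0`; a Mellin/Perron identity for the tent `f̃` of
(2.28), no character involved; blanket (A) kept as the standing hypothesis). CLAIM (identity).
[cite: Zhang2022LandauSiegel, §10 (10.6), p. 54] -/
def Eq106 : Prop :=
  ForAllLarge fun D _ χ => AssumptionA D χ → ∀ y : ℝ, 0 < y →
    (ftilde (Real.log y / Real.log (bigP D)) : ℂ) =
      (500 : ℂ) / (Real.log (bigP D) : ℂ) *
        lineInt 1 (fun s => ((Pp1 D : ℂ) ^ s - 2 * (Pp2 D : ℂ) ^ s + (Pp3 D : ℂ) ^ s) /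
          (y : ℂ) ^ s / s ^ 2)

/-- **(10.7)** (Z22:(10.7), p. 54, tex L2762): "In the case `P^{0.5} < y ≤ P^{0.502}/T`,
`𝔳₁ⱼ(y) = (500/log P)·(1/2πi)∫_{(1)} L(1 − β_j + s, χ)((P′₁)ˢ − 2(P′₂)ˢ) y⁻ˢ ds/s²` by (10.6)."
CLAIM (identity; `𝔳₁ⱼ` = `Skeleton.frakv1`). [cite: Zhang2022LandauSiegel, §10 (10.7), p. 54] -/
def Eq107 : Prop :=
  ForAllLarge fun D _ χ => AssumptionA D χ → ∀ j ∈ ({1, 2, 3} : Finset ℕ), ∀ y : ℝ,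
    bigP D ^ (0.5 : ℝ) < y → y ≤ bigP D ^ (0.502 : ℝ) / bigT D →
      frakv1 c' χ j y = (500 : ℂ) / (Real.log (bigP D) : ℂ) *
        lineInt 1 (fun s => χ.LFunction (1 - betaJ c' D j + s) *
          (((Pp1 D : ℂ) ^ s - 2 * (Pp2 D : ℂ) ^ s) / (y : ℂ) ^ s) / s ^ 2)

/-- **Z22:§10.u010** (p. 54, tex L2767): "The contour of integration is moved in the same way as in
the proof of lemma 8.1 [sic: the contour described is that of the proof of Lemma 8.2 — segments
`Re s = α` (`|t| ≥ D`), `Re s = −𝓛⁻¹` (`|t| ≤ D`), the horizontals `t = ±D`, leaving the circle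
`|s| = 5α`]. Hence, by Lemma 5.8, the right side above [of (10.7)] is equal to
`(500L′(1,χ)/log P)·(1/2πi)∫_{|s|=5α} ((P′₁)ˢ − 2(P′₂)ˢ) y⁻ˢ (s − β_j) ds/s² + o(𝓛⁻¹⁵)`"
(case `P^{0.5} < y ≤ P^{0.502}/T`). CLAIM.
[cite: Zhang2022LandauSiegel, §10 p. 54, tex L2767] -/
def Step10u010 : Prop :=
  ∀ ε : ℝ, 0 < ε → ForAllLarge fun D _ χ => AssumptionA D χ → ∀ j ∈ ({1, 2, 3} : Finset ℕ),
    ∀ y : ℝ, bigP D ^ (0.5 : ℝ) < y → y ≤ bigP D ^ (0.502 : ℝ) / bigT D →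
      ‖(500 : ℂ) / (Real.log (bigP D) : ℂ) *
            lineInt 1 (fun s => χ.LFunction (1 - betaJ c' D j + s) *
              (((Pp1 D : ℂ) ^ s - 2 * (Pp2 D : ℂ) ^ s) / (y : ℂ) ^ s) / s ^ 2) -
          (500 : ℂ) * deriv χ.LFunction 1 / (Real.log (bigP D) : ℂ) *
            ((2 * π * I)⁻¹ * ∮ s in C(0, 5 * alpha D),
              ((Pp1 D : ℂ) ^ s - 2 * (Pp2 D : ℂ) ^ s) / (y : ℂ) ^ s * (s - betaJ c' D j) / s ^ 2)‖
        ≤ ε * (ell D ^ 15)⁻¹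

/-- **Z22:§10.u011** (p. 54, tex L2772): "The[!] yields (11.3) [sic: (10.3)] since the residue of the
function `((P′₁)ˢ − 2(P′₂)ˢ) y⁻ˢ (s − β_j)/s²` at `s = 0` is equal to `−1 − β_j log(y/P^{0.5})`."
The function is meromorphic on `ℂ` with its only pole at `0`, so its residue there is its normalised
integral over EVERY circle `C(0,r)`, `r > 0` — typed in that form (the manuscript uses `r = 5α`).
Blanket (A) kept. CLAIM (PROVED below, unconditionally, from the tree's `lemma101_range2`:
`residue101_eq`, `step10u011_holds`). [cite: Zhang2022LandauSiegel, §10 p. 54, tex L2772] -/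
def Step10u011 : Prop :=
  ForAllLarge fun D _ χ => AssumptionA D χ →
    ∀ j ∈ ({1, 2, 3} : Finset ℕ), ∀ y : ℝ, 0 < y → ∀ r : ℝ, 0 < r →
    (2 * π * I)⁻¹ * (∮ s in C(0, r),
        ((Pp1 D : ℂ) ^ s - 2 * (Pp2 D : ℂ) ^ s) / (y : ℂ) ^ s * (s - betaJ c' D j) / s ^ 2) =
      -1 - betaJ c' D j * (Real.log (y / bigP D ^ (0.5 : ℝ)) : ℂ)

/-- **Z22:§10.u012** (p. 54, tex L2778): "Similarly, in the case `P^{0.502} < y ≤ P^{0.504}/T` we have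
`𝔳₁ⱼ(y) = (500/log P)·(1/2πi)∫_{(1)} L(1 − β_j + s, χ)(P′₁/y)ˢ ds/s²`. This yields (10.4) in a way
similar to the proof of (10.3)." CLAIM (identity). [cite: Zhang2022LandauSiegel, §10 p. 54, tex L2778] -/
def Step10u012 : Prop :=
  ForAllLarge fun D _ χ => AssumptionA D χ → ∀ j ∈ ({1, 2, 3} : Finset ℕ), ∀ y : ℝ,
    bigP D ^ (0.502 : ℝ) < y → y ≤ bigP D ^ (0.504 : ℝ) / bigT D →
      frakv1 c' χ j y = (500 : ℂ) / (Real.log (bigP D) : ℂ) *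
        lineInt 1 (fun s => χ.LFunction (1 - betaJ c' D j + s) *
          ((Pp1 D / y : ℝ) : ℂ) ^ s / s ^ 2)

/-- **Z22:§10.u013** (p. 54, tex L2785): "In the case `y ∈ (P^{0.5}/T, P^{0.5}] ∪ (P^{0.504}/T, P^{0.504})`
and `m < T`, we have `f̃(log(ym)/log P) ≪ α₁`, so (10.5) follows by the Polya-Vinogradov inequality and
partial summation". `α₁` is NOT defined in v1 (read1-12); typed with the campaign reading `α₁ = α𝓛`
(skel/GAP-NODE-MAP) — NB for the adjudicators (not a typing choice): on these windows
`|log(ym)/log P − a| < log T/log P = 𝓛^{−7.9}` (`a = 0.5`, `0.504`), so the display holds for any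
`α₁ ≫ 𝓛^{−7.9}`, while `α𝓛 = π𝓛⁻⁸`. Pólya–Vinogradov = FACT-LIST F-16, tree theorem
`Literature.NumberTheory.LFunctions.norm_partialSum_le_polyaVinogradov`. CLAIM.
[cite: Zhang2022LandauSiegel, §10 p. 54, tex L2785] -/
def Step10u013 : Prop :=
  ∃ C : ℝ, ForAllLarge fun D _ χ => AssumptionA D χ → ∀ y : ℝ,
    y ∈ Set.Ioc (bigP D ^ (0.5 : ℝ) / bigT D) (bigP D ^ (0.5 : ℝ)) ∪
        Set.Ioo (bigP D ^ (0.504 : ℝ) / bigT D) (bigP D ^ (0.504 : ℝ)) →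
      ∀ m : ℕ, 1 ≤ m → (m : ℝ) < bigT D →
        |ftilde (Real.log (y * m) / Real.log (bigP D))| ≤ C * (alpha D * ell D)

/-- **Z22:Lem10.1.pf** — the proof of Lemma 10.1 (pp. 54–55, tex L2751–L2786) as a deduction node:
"(10.2) by the Polya-Vinogradov inequality [FACT-LIST F-16 = tree THEOREM
`Literature.NumberTheory.LFunctions.norm_partialSum_le_polyaVinogradov`; apply it, no binder] and partial
summation"; (10.3) from (10.6), (10.7), the contour shift + Lemma 5.8 (u010) and the residue
(u011); (10.4) "similarly" from u012; (10.5) from u013 (+ Pólya–Vinogradov) and, on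
`(P^{0.502}/T, P^{0.502}]`, from (10.7) "and a simple estimate for the integral on the new segments".
Typed as the implication from the displayed steps and the cited Lemma 5.8 (`Skeleton.Lemma58`, PROVED
in the tree) to `Skeleton.Lemma101 c'`; the undisplayed estimates are the discharger's.
CLAIM (deduction). [cite: Zhang2022LandauSiegel, §10 Lemma 10.1 (proof), pp. 54–55, tex L2751] -/
def Lemma101Proof : Prop :=
  Lemma58 → Eq106 → Eq107 c' → Step10u010 c' → Step10u011 c' → Step10u012 c' → Step10u013 →
    Lemma101 c'

end Lemma101Proof

/-! ## Lemma 10.2 (pp. 55): the four ranges (10.8)–(10.11) as separate nodes -/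

section Lemma102Nodes

variable (c' : ℝ)

/-- **(10.8)** (Z22:(10.8), p. 55, tex L2794; `𝔳₂ⱼ(d,r)` = `Skeleton.frakv2`, `Π(d,r)` = `Skeleton.PiW`):
"If `dr ≤ P^{0.5}/T`, then `𝔳₂ⱼ(d,r) = (L′(1,χ)Π(d,r)/500) β_{j+1}β_{j+2} log P + O(𝓛⁻¹⁵)`". CLAIM
(first clause of `Skeleton.Lemma102`). [cite: Zhang2022LandauSiegel, §10 (10.8), p. 55] -/
def Eq108 : Prop :=
  ∃ C : ℝ, ForAllLarge fun D _ χ => AssumptionA D χ →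
    ∀ j ∈ ({1, 2, 3} : Finset ℕ), ∀ d r : ℕ, 1 ≤ d → 1 ≤ r →
      ((d * r : ℕ) : ℝ) ≤ bigP D ^ (0.5 : ℝ) / bigT D →
        ‖frakv2 c' χ j d r - deriv χ.LFunction 1 * PiW χ d r / 500 *
          (betaJ c' D (j + 1) * betaJ c' D (j + 2)) * Real.log (bigP D)‖ ≤ C * (ell D ^ 15)⁻¹

/-- **(10.9)** (Z22:(10.9), p. 55, tex L2798; `𝔶₁ⱼ` = `Skeleton.fraky1`, Z22:§10.u015):
"if `P^{0.5} < dr ≤ P^{0.502}/T`, then `𝔳₂ⱼ(d,r) = (500L′(1,χ)Π(d,r)/log P)(−1 + 𝔶₁ⱼ(dr)) + O(𝓛⁻¹⁵)`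
with `𝔶₁ⱼ(y) = (β_{j+1} + β_{j+2})log(y/P^{0.5}) + ½β_{j+1}β_{j+2}(log²(P^{0.504}/y) − 2log²(P^{0.502}/y))`".
CLAIM. [cite: Zhang2022LandauSiegel, §10 (10.9), p. 55] -/
def Eq109 : Prop :=
  ∃ C : ℝ, ForAllLarge fun D _ χ => AssumptionA D χ →
    ∀ j ∈ ({1, 2, 3} : Finset ℕ), ∀ d r : ℕ, 1 ≤ d → 1 ≤ r →
      bigP D ^ (0.5 : ℝ) < ((d * r : ℕ) : ℝ) → ((d * r : ℕ) : ℝ) ≤ bigP D ^ (0.502 : ℝ) / bigT D →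
        ‖frakv2 c' χ j d r - 500 * deriv χ.LFunction 1 * PiW χ d r / Real.log (bigP D) *
          (-1 + fraky1 c' D j ((d * r : ℕ) : ℝ))‖ ≤ C * (ell D ^ 15)⁻¹

/-- **(10.10)** (Z22:(10.10), p. 55, tex L2806; `𝔶₂ⱼ` = `Skeleton.fraky2`, Z22:§10.u016):
"if `P^{0.502} < dr ≤ P^{0.504}/T`, then `𝔳₂ⱼ(d,r) = (500L′(1,χ)Π(d,r)/log P)(1 + 𝔶₂ⱼ(dr)) + O(𝓛⁻¹⁵)`
with `𝔶₂ⱼ(y) = (β_{j+1} + β_{j+2})log(P^{0.504}/y) + ½β_{j+1}β_{j+2}log²(P^{0.504}/y)`". CLAIM.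
[cite: Zhang2022LandauSiegel, §10 (10.10), p. 55] -/
def Eq1010 : Prop :=
  ∃ C : ℝ, ForAllLarge fun D _ χ => AssumptionA D χ →
    ∀ j ∈ ({1, 2, 3} : Finset ℕ), ∀ d r : ℕ, 1 ≤ d → 1 ≤ r →
      bigP D ^ (0.502 : ℝ) < ((d * r : ℕ) : ℝ) → ((d * r : ℕ) : ℝ) ≤ bigP D ^ (0.504 : ℝ) / bigT D →
        ‖frakv2 c' χ j d r - 500 * deriv χ.LFunction 1 * PiW χ d r / Real.log (bigP D) *
          (1 + fraky2 c' D j ((d * r : ℕ) : ℝ))‖ ≤ C * (ell D ^ 15)⁻¹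

/-- **(10.11)** (Z22:(10.11), p. 55, tex L2817; range Z22:§10.u017 = `edgeWindows D` at `y = dr`):
"if `dr ∈ (P^{0.5}/T, P^{0.5}] ∪ (P^{0.502}/T, P^{0.502}] ∪ (P^{0.504}/T, P^{0.504})`, then
`𝔳₂ⱼ(d,r) ≪ 𝓛⁻⁷`". CLAIM. [cite: Zhang2022LandauSiegel, §10 (10.11), p. 55] -/
def Eq1011 : Prop :=
  ∃ C : ℝ, ForAllLarge fun D _ χ => AssumptionA D χ →
    ∀ j ∈ ({1, 2, 3} : Finset ℕ), ∀ d r : ℕ, 1 ≤ d → 1 ≤ r →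
      ((d * r : ℕ) : ℝ) ∈ edgeWindows D → ‖frakv2 c' χ j d r‖ ≤ C * (ell D ^ 7)⁻¹

end Lemma102Nodes

/-! ## Proof of Lemma 10.2 (pp. 55–56): the displayed steps -/

section Lemma102Proof

variable (c' : ℝ)

/-- **Z22:§10.u018** (p. 55, tex L2824): "First assume `dr ≤ P^{0.5}/T`. In view of (8.9) [i.e. the
identity `Σ_n χ(n)ξ₀ⱼ(n;d,r)n^{−(1+s)} = L(1+s+β_{j+1},χ)L(1+s+β_{j+2},χ)𝔲ⱼ(d,r;1+s)/L(1+s,χ)`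
recalled after (8.9), §8 p. 47] and (10.6), we have
`𝔳₂ⱼ(d,r) = (500/log P)·∫_{(1)} [L(1+β_{j+1}+s,χ)L(1+β_{j+2}+s,χ)𝔲₀ⱼ(s;d,r)/L(1+s,χ)]
× ((P′₁)ˢ − 2(P′₂)ˢ + (P′₃)ˢ)(dr)⁻ˢ ds/s²`". Printed with a bare `∫_{(1)}`; typed with the
`(1/2πi)` of (10.6) which it invokes (the value (10.8) it yields requires it). `𝔲₀ⱼ(s;d,r)` is
Lemma 8.3's `𝔲ⱼ(d,r;1+s)`; as in `Skeleton.Lemma83` it enters as ANY function `U` agreeing with the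
defining product `L(w,χ)/(L(w+β_{j+1},χ)L(w+β_{j+2},χ))·Σ_nχ(n)ξ₀ⱼ(n;d,r)n^{−w}` on `Re w > 1`
(`Skeleton.xiSeries`). CLAIM (identity). [cite: Zhang2022LandauSiegel, §10 p. 55, tex L2824] -/
def Step10u018 : Prop :=
  ForAllLarge fun D _ χ => AssumptionA D χ → ∀ j ∈ ({1, 2, 3} : Finset ℕ), ∀ d r : ℕ,
    1 ≤ d → 1 ≤ r → ((d * r : ℕ) : ℝ) ≤ bigP D ^ (0.5 : ℝ) / bigT D →
      ∀ U : ℂ → ℂ,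
        (∀ w : ℂ, 1 < w.re → U w = χ.LFunction w /
            (χ.LFunction (w + betaJ c' D (j + 1)) * χ.LFunction (w + betaJ c' D (j + 2))) *
              xiSeries c' χ j d r w) →
        frakv2 c' χ j d r = (500 : ℂ) / (Real.log (bigP D) : ℂ) *
          lineInt 1 (fun s =>
            χ.LFunction (1 + betaJ c' D (j + 1) + s) * χ.LFunction (1 + betaJ c' D (j + 2) + s) *
                U (1 + s) / χ.LFunction (1 + s) *
              (((Pp1 D : ℂ) ^ s - 2 * (Pp2 D : ℂ) ^ s + (Pp3 D : ℂ) ^ s) / ((d * r : ℕ) : ℂ) ^ s) /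
              s ^ 2)

/-- **Z22:§10.u019** (p. 56, tex L2831): "The contour of integration is moved in the same way as the
proof of Lemma 8.1 [sic: 8.2]. Thus, by Lemma 5.8 and 8.2 [sic: `Π(d,r)` is Lemma 8.3's; NB Lemma 8.3
states `𝔲ⱼ = Π(d,r) + O(𝓛⁻⁸)` for `|s − 1| ≤ 5α` whereas this circle is `|s| = 10α`],
`𝔳₂ⱼ(d,r) = (500L′(1,χ)Π(d,r)/log P)·∫_{|s|=10α} [(β_{j+1}+s)(β_{j+2}+s)/s]
((P′₁)ˢ − 2(P′₂)ˢ + (P′₃)ˢ)(dr)⁻ˢ ds/s² + O(𝓛⁻¹⁵)`" (case `dr ≤ P^{0.5}/T`; printed with a bare `∫`,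
typed with `1/2πi` as in the two displays that follow). CLAIM.
[cite: Zhang2022LandauSiegel, §10 p. 56, tex L2831] -/
def Step10u019 : Prop :=
  ∃ C : ℝ, ForAllLarge fun D _ χ => AssumptionA D χ → ∀ j ∈ ({1, 2, 3} : Finset ℕ), ∀ d r : ℕ,
    1 ≤ d → 1 ≤ r → ((d * r : ℕ) : ℝ) ≤ bigP D ^ (0.5 : ℝ) / bigT D →
      ‖frakv2 c' χ j d r -
          (500 : ℂ) * deriv χ.LFunction 1 * PiW χ d r / (Real.log (bigP D) : ℂ) *
            ((2 * π * I)⁻¹ * ∮ s in C(0, 10 * alpha D),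
              (betaJ c' D (j + 1) + s) * (betaJ c' D (j + 2) + s) / s *
                (((Pp1 D : ℂ) ^ s - 2 * (Pp2 D : ℂ) ^ s + (Pp3 D : ℂ) ^ s) /
                  ((d * r : ℕ) : ℂ) ^ s) / s ^ 2)‖
        ≤ C * (ell D ^ 15)⁻¹

/-- **Z22:§10.u020** (p. 56, tex L2836): "This yields (10.8) since the function
`((P′₁)ˢ − 2(P′₂)ˢ + (P′₃)ˢ)/s²` is analytic and equal to `(log P/500)²` at `s = 0`" — i.e. it has a
removable singularity at `0` (its numerator vanishes to second order: `1 − 2 + 1 = 0`,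
`0.504 − 2·0.502 + 0.5 = 0`) and the value of its entire extension at `0` is
`½(0.504² − 2·0.502² + 0.5²)log²P = (log P/500)²` (tree `tent_sq3`). Blanket (A) kept. CLAIM.
[cite: Zhang2022LandauSiegel, §10 p. 56, tex L2836] -/
def Step10u020 : Prop :=
  ForAllLarge fun D _ χ => AssumptionA D χ → ∃ g : ℂ → ℂ, Differentiable ℂ g ∧
    (∀ s : ℂ, s ≠ 0 → g s = ((Pp1 D : ℂ) ^ s - 2 * (Pp2 D : ℂ) ^ s + (Pp3 D : ℂ) ^ s) / s ^ 2) ∧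
    g 0 = (((Real.log (bigP D) / 500) ^ 2 : ℝ) : ℂ)

/-- **Z22:§10.u021, AS PRINTED** (p. 56, tex L2842): "Similarly, in the case `P^{0.5}/T < dr ≤ P^{0.502}`
we have `𝔳₂ⱼ(d,r) = (500L′(1,χ)Π(d,r)/log P)·(1/2πi)∫_{|s|=10α} [(β_{j+1}+s)(β_{j+2}+s)/s]
((P′₁)ˢ − 2(P′₂)ˢ)(dr)⁻ˢ ds/s² + O(𝓛⁻¹⁵)`". The printed range differs from that of (10.9)
(`P^{0.5} < dr ≤ P^{0.502}/T`), which this display is said to yield; the verbatim range is typed here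
and (10.9)'s range in `Step10u021r` (`step10u021r_of`: this one implies that one). CLAIM.
[cite: Zhang2022LandauSiegel, §10 p. 56, tex L2842] -/
def Step10u021 : Prop :=
  ∃ C : ℝ, ForAllLarge fun D _ χ => AssumptionA D χ → ∀ j ∈ ({1, 2, 3} : Finset ℕ), ∀ d r : ℕ,
    1 ≤ d → 1 ≤ r →
      bigP D ^ (0.5 : ℝ) / bigT D < ((d * r : ℕ) : ℝ) → ((d * r : ℕ) : ℝ) ≤ bigP D ^ (0.502 : ℝ) →
        ‖frakv2 c' χ j d r -
            (500 : ℂ) * deriv χ.LFunction 1 * PiW χ d r / (Real.log (bigP D) : ℂ) *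
              ((2 * π * I)⁻¹ * ∮ s in C(0, 10 * alpha D),
                (betaJ c' D (j + 1) + s) * (betaJ c' D (j + 2) + s) / s *
                  (((Pp1 D : ℂ) ^ s - 2 * (Pp2 D : ℂ) ^ s) / ((d * r : ℕ) : ℂ) ^ s) / s ^ 2)‖
          ≤ C * (ell D ^ 15)⁻¹

/-- **Z22:§10.u021 on the range of (10.9)** (`P^{0.5} < dr ≤ P^{0.502}/T`): the same display,
implied by the verbatim one (`step10u021r_of`) and the form from which (10.9) is read off.
[cite: Zhang2022LandauSiegel, §10 p. 56, tex L2842; (10.9) p. 55] -/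
def Step10u021r : Prop :=
  ∃ C : ℝ, ForAllLarge fun D _ χ => AssumptionA D χ → ∀ j ∈ ({1, 2, 3} : Finset ℕ), ∀ d r : ℕ,
    1 ≤ d → 1 ≤ r →
      bigP D ^ (0.5 : ℝ) < ((d * r : ℕ) : ℝ) → ((d * r : ℕ) : ℝ) ≤ bigP D ^ (0.502 : ℝ) / bigT D →
        ‖frakv2 c' χ j d r -
            (500 : ℂ) * deriv χ.LFunction 1 * PiW χ d r / (Real.log (bigP D) : ℂ) *
              ((2 * π * I)⁻¹ * ∮ s in C(0, 10 * alpha D),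
                (betaJ c' D (j + 1) + s) * (betaJ c' D (j + 2) + s) / s *
                  (((Pp1 D : ℂ) ^ s - 2 * (Pp2 D : ℂ) ^ s) / ((d * r : ℕ) : ℂ) ^ s) / s ^ 2)‖
          ≤ C * (ell D ^ 15)⁻¹

/-- **Z22:§10.u022** (p. 56, tex L2847): "in the case `P^{0.502} < dr ≤ P^{0.504}/T` we have
`𝔳₂ⱼ(d,r) = (500L′(1,χ)Π(d,r)/log P)·(1/2πi)∫_{|s|=10α} [(β_{j+1}+s)(β_{j+2}+s)/s] (P′₁/dr)ˢ ds/s²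
+ O(𝓛⁻¹⁵)`. These yield (10.9) and (10.10)." CLAIM. [cite: Zhang2022LandauSiegel, §10 p. 56, tex L2847] -/
def Step10u022 : Prop :=
  ∃ C : ℝ, ForAllLarge fun D _ χ => AssumptionA D χ → ∀ j ∈ ({1, 2, 3} : Finset ℕ), ∀ d r : ℕ,
    1 ≤ d → 1 ≤ r →
      bigP D ^ (0.502 : ℝ) < ((d * r : ℕ) : ℝ) → ((d * r : ℕ) : ℝ) ≤ bigP D ^ (0.504 : ℝ) / bigT D →
        ‖frakv2 c' χ j d r -
            (500 : ℂ) * deriv χ.LFunction 1 * PiW χ d r / (Real.log (bigP D) : ℂ) *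
              ((2 * π * I)⁻¹ * ∮ s in C(0, 10 * alpha D),
                (betaJ c' D (j + 1) + s) * (betaJ c' D (j + 2) + s) / s *
                  ((Pp1 D / ((d * r : ℕ) : ℝ) : ℝ) : ℂ) ^ s / s ^ 2)‖
          ≤ C * (ell D ^ 15)⁻¹

/-- **Z22:Lem10.2.pf** — the proof of Lemma 10.2 (pp. 55–56, tex L2823–L2851) as a deduction node:
(10.8) from u018, u019 and u020; (10.9), (10.10) from u021, u022 ("These yield (10.9) and (10.10)");
"The proof of (10.11) is similar to that of (10.5) in the case `y ∈ (P^{0.502}/T, P^{0.502}]`"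
(Pólya–Vinogradov where invoked = FACT-LIST F-16, tree theorem `norm_partialSum_le_polyaVinogradov`).
Antecedents: the displayed steps, the cited Lemma 5.8 (`Skeleton.Lemma58`, PROVED in the tree) and
Lemma 8.2 (`Skeleton.Lemma82 c'`, PROVED for `c′ ≥ 0`) as printed, and Lemma 8.3
(`Skeleton.Lemma83 c'`, the source of `Π(d,r)`); u021 enters on (10.9)'s range (`Step10u021r`).
CLAIM (deduction). [cite: Zhang2022LandauSiegel, §10 Lemma 10.2 (proof), pp. 55–56, tex L2823] -/
def Lemma102Proof : Prop :=
  Lemma58 → Lemma82 c' → Lemma83 c' → Step10u018 c' → Step10u019 c' → Step10u020 →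
    Step10u021r c' → Step10u022 c' → Lemma102 c'

end Lemma102Proof

/-! ## "By direct calculation" (p. 56, tex L2856–L2867): the main values of the `β`'s and `𝔶`'s -/

section DirectCalculation

variable (c' : ℝ)

/-- **Z22:§10.u023** (p. 56, tex L2857): "By direct calculation, for `0 ≤ z ≤ 1` we have
`β_j log P^{z−0.5} = πij(z − 0.5) + O(𝓛⁻⁸)`, `β_j log P^{0.504−z} = πij(0.504 − z) + O(𝓛⁻⁸)`"
(`1 ≤ j ≤ 3`; `β_j` = `Skeleton.betaJ c'`, with their `c′α𝓛`-corrections (2.13)). CLAIM;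
NUM:pending (plan/L3/ASSIGNMENTS.md §4). Blanket (A) kept. [cite: Zhang2022LandauSiegel, §10 p. 56, tex L2857] -/
def Step10u023 : Prop :=
  ∃ C : ℝ, ForAllLarge fun D _ χ => AssumptionA D χ →
    ∀ j ∈ ({1, 2, 3} : Finset ℕ), ∀ z : ℝ, 0 ≤ z → z ≤ 1 →
    ‖betaJ c' D j * (Real.log (bigP D ^ (z - 0.5)) : ℂ) - π * I * j * ((z - 0.5 : ℝ) : ℂ)‖
        ≤ C * (ell D ^ 8)⁻¹ ∧
      ‖betaJ c' D j * (Real.log (bigP D ^ (0.504 - z)) : ℂ) - π * I * j * ((0.504 - z : ℝ) : ℂ)‖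
        ≤ C * (ell D ^ 8)⁻¹

/-- **Z22:§10.u024** (p. 56, tex L2860): "`𝔶₁ⱼ(Pᶻ) = 𝔶𝔶₁ⱼ(z) + O(𝓛⁻⁸)`, `𝔶₂ⱼ(Pᶻ) = 𝔶𝔶₂ⱼ(z) + O(𝓛⁻⁸)`"
(for `0 ≤ z ≤ 1`, `1 ≤ j ≤ 3`), where the six polynomials `𝔶𝔶₁₁ … 𝔶𝔶₂₃` displayed next (tex
L2864–L2875; Z22:§10.u025–u030) are the tree's `Zhang2022.yy11, yy21, yy12, yy22, yy13, yy23`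
(`Section10Defs`; the tree proves the EXACT main-value versions `yfrak1_main_1` … `yfrak2_main_3`).
`𝔶₁ⱼ, 𝔶₂ⱼ` = `Skeleton.fraky1/2 c'`. Blanket (A) kept. CLAIM. [cite: Zhang2022LandauSiegel, §10 p. 56, tex L2860] -/
def Step10u024 : Prop :=
  ∃ C : ℝ, ForAllLarge fun D _ χ => AssumptionA D χ →
    ∀ j ∈ ({1, 2, 3} : Finset ℕ), ∀ z : ℝ, 0 ≤ z → z ≤ 1 →
    ‖fraky1 c' D j (bigP D ^ z) - (if j = 1 then yy11 z else if j = 2 then yy12 z else yy13 z)‖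
        ≤ C * (ell D ^ 8)⁻¹ ∧
      ‖fraky2 c' D j (bigP D ^ z) - (if j = 1 then yy21 z else if j = 2 then yy22 z else yy23 z)‖
        ≤ C * (ell D ^ 8)⁻¹

/-- **Z22:§10.u025** (p. 56, tex L2864): "`𝔶𝔶₁₁(z) = 5πi(z − 0.5) − 3π²((0.504 − z)² − 2(0.502 − z)²)`"
— this IS the tree's `Zhang2022.yy11 = yy1F 5 (−3)` (`Section10Defs`), checked against the printed
display. [cite: Zhang2022LandauSiegel, §10 p. 56, tex L2864] -/
theorem yy11_eq_printed (z : ℝ) :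
    yy11 z = 5 * π * I * (z - 0.5) - 3 * π ^ 2 * ((0.504 - z) ^ 2 - 2 * (0.502 - z) ^ 2) := by
  simp only [yy11, yy1F]
  push_cast
  ring

/-- **Z22:§10.u026** (p. 56, tex L2867): "`𝔶𝔶₂₁(z) = 5πi(0.504 − z) − 3π²(0.504 − z)²`" — the tree's
`Zhang2022.yy21 = yy2F 5 (−3)`. [cite: Zhang2022LandauSiegel, §10 p. 56, tex L2867] -/
theorem yy21_eq_printed (z : ℝ) :
    yy21 z = 5 * π * I * (0.504 - z) - 3 * π ^ 2 * (0.504 - z) ^ 2 := by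
  simp only [yy21, yy2F]
  push_cast
  ring

end DirectCalculation

/-! ## Kernel-checked edges and elementary discharges -/

section Edges

variable (c' : ℝ)

/-- The section-level deduction node FOLLOWS from the skeleton's `Ded1017` ((10.12)–(10.17)) and the
banked edge `prop24_of_eval1017` ((10.17) + `|𝔡′ + 𝔡| > 5` + `𝔞 ≫ 1` ⇒ Prop. 2.4).
[cite: Zhang2022LandauSiegel, §10 pp. 53–62] -/
theorem prop24Proof_of_ded1017 (h : Ded1017 c') : Prop24Proof c' :=
  fun h101 h71 h82 h83 h84 hL101 hL102 =>
    prop24_of_eval1017 (h h101 h71 h82 h83 h84 hL101 hL102)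

/-- The verbatim-range display u021 implies the (10.9)-range one (`P^{0.5}/T ≤ P^{0.5}` and
`P^{0.502}/T ≤ P^{0.502}` as `T ≥ 1`). [cite: Zhang2022LandauSiegel, §10 p. 56, tex L2842] -/
theorem step10u021r_of (h : Step10u021 c') : Step10u021r c' := by
  obtain ⟨C, hF⟩ := h
  refine ⟨C, hF.mono fun D _ χ _ _ h hA j hj d r hd hr h1 h2 => h hA j hj d r hd hr ?_ ?_⟩
  · have hT : 1 ≤ bigT D := Real.one_le_exp (Real.rpow_nonneg (Real.log_natCast_nonneg D) _)
    have hP : 0 ≤ bigP D ^ (0.5 : ℝ) := Real.rpow_nonneg (Real.exp_pos _).le _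
    exact lt_of_le_of_lt (div_le_self hP hT) h1
  · have hT : 1 ≤ bigT D := Real.one_le_exp (Real.rpow_nonneg (Real.log_natCast_nonneg D) _)
    have hP : 0 ≤ bigP D ^ (0.502 : ℝ) := Real.rpow_nonneg (Real.exp_pos _).le _
    exact h2.trans (div_le_self hP hT)

/-- **Lemma 10.1 ⇔ its four displays** (10.2)–(10.5): the banked node `Skeleton.Lemma101 c'` is the
conjunction of `Eq102`–`Eq105` (constants merged by `max`). [cite: Zhang2022LandauSiegel, §10 Lemma 10.1] -/
theorem lemma101_iff_eqs : Lemma101 c' ↔ Eq102 c' ∧ Eq103 c' ∧ Eq104 c' ∧ Eq105 c' := by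
  constructor
  · rintro ⟨c, hc, C, hF⟩
    refine ⟨⟨c, hc, C, hF.mono fun D _ χ _ _ h hA j hj y => (h hA j hj y).1⟩,
      ⟨C, hF.mono fun D _ χ _ _ h hA j hj y => (h hA j hj y).2.1⟩,
      ⟨C, hF.mono fun D _ χ _ _ h hA j hj y => (h hA j hj y).2.2.1⟩,
      ⟨C, hF.mono fun D _ χ _ _ h hA j hj y hy => (h hA j hj y).2.2.2 ?_⟩⟩
    exact (mem_edgeWindows_iff D y).mp hy
  · rintro ⟨⟨c, hc, C₂, h₂⟩, ⟨C₃, h₃⟩, ⟨C₄, h₄⟩, ⟨C₅, h₅⟩⟩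
    refine ⟨c, hc, max (max C₂ C₃) (max C₄ C₅), ((h₂.and h₃).and (h₄.and h₅)).mono ?_⟩
    intro D _ χ _ _ h hA j hj y
    obtain ⟨⟨k₂, k₃⟩, k₄, k₅⟩ := h
    have hT : 0 ≤ bigT D ^ (-c) := Real.rpow_nonneg (Real.exp_pos _).le _
    have h15 := ell_pow_inv_nonneg D 15
    have h7 := ell_pow_inv_nonneg D 7
    refine ⟨fun hy1 hy2 => (k₂ hA j hj y hy1 hy2).trans
        (mul_le_mul_of_nonneg_right ((le_max_left _ _).trans (le_max_left _ _)) hT),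
      fun hy1 hy2 => (k₃ hA j hj y hy1 hy2).trans
        (mul_le_mul_of_nonneg_right ((le_max_right _ _).trans (le_max_left _ _)) h15),
      fun hy1 hy2 => (k₄ hA j hj y hy1 hy2).trans
        (mul_le_mul_of_nonneg_right ((le_max_left _ _).trans (le_max_right _ _)) h15),
      fun hy => (k₅ hA j hj y ((mem_edgeWindows_iff D y).mpr hy)).trans
        (mul_le_mul_of_nonneg_right ((le_max_right _ _).trans (le_max_right _ _)) h7)⟩

/-- **Lemma 10.2 ⇔ its four displays** (10.8)–(10.11). [cite: Zhang2022LandauSiegel, §10 Lemma 10.2] -/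
theorem lemma102_iff_eqs : Lemma102 c' ↔ Eq108 c' ∧ Eq109 c' ∧ Eq1010 c' ∧ Eq1011 c' := by
  constructor
  · rintro ⟨C, hF⟩
    refine ⟨⟨C, hF.mono fun D _ χ _ _ h hA j hj d r hd hr => (h hA j hj d r hd hr).1⟩,
      ⟨C, hF.mono fun D _ χ _ _ h hA j hj d r hd hr => (h hA j hj d r hd hr).2.1⟩,
      ⟨C, hF.mono fun D _ χ _ _ h hA j hj d r hd hr => (h hA j hj d r hd hr).2.2.1⟩,
      ⟨C, hF.mono fun D _ χ _ _ h hA j hj d r hd hr hy => (h hA j hj d r hd hr).2.2.2 ?_⟩⟩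
    exact (mem_edgeWindows_iff D _).mp hy
  · rintro ⟨⟨C₂, h₂⟩, ⟨C₃, h₃⟩, ⟨C₄, h₄⟩, ⟨C₅, h₅⟩⟩
    refine ⟨max (max C₂ C₃) (max C₄ C₅), ((h₂.and h₃).and (h₄.and h₅)).mono ?_⟩
    intro D _ χ _ _ h hA j hj d r hd hr
    obtain ⟨⟨k₂, k₃⟩, k₄, k₅⟩ := h
    have h15 := ell_pow_inv_nonneg D 15
    have h7 := ell_pow_inv_nonneg D 7
    refine ⟨fun hy => (k₂ hA j hj d r hd hr hy).trans
        (mul_le_mul_of_nonneg_right ((le_max_left _ _).trans (le_max_left _ _)) h15),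
      fun hy1 hy2 => (k₃ hA j hj d r hd hr hy1 hy2).trans
        (mul_le_mul_of_nonneg_right ((le_max_right _ _).trans (le_max_left _ _)) h15),
      fun hy1 hy2 => (k₄ hA j hj d r hd hr hy1 hy2).trans
        (mul_le_mul_of_nonneg_right ((le_max_left _ _).trans (le_max_right _ _)) h15),
      fun hy => (k₅ hA j hj d r hd hr ((mem_edgeWindows_iff D _).mpr hy)).trans
        (mul_le_mul_of_nonneg_right ((le_max_right _ _).trans (le_max_right _ _)) h7)⟩

end Edges

/-! ### The reflections u001, u002 (proved) -/

section Reflections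

variable {D : ℕ} [NeZero D] (χ : DirichletCharacter ℂ D) (x : Chr D)

omit [NeZero D] in
/-- `J₁(w,ψ̄)` is a finite sum over `n < ⌈PT⁻²⌉` (for `𝓛 ≥ 2`), as `J₁` is (`Skeleton.J1_eq_sum`).
[cite: Zhang2022LandauSiegel, §2 (2.29)] -/
theorem J1Bar_eq_sum (hD : 2 ≤ Real.log D) (w : ℂ) :
    J1Bar χ x w = ∑ n ∈ Finset.range (Nsupp D),
      χ (n : ZMod D) * conj (x.ψ (n : ZMod x.p)) * (n : ℂ) ^ (-w) *
        (ftilde (Real.log n / Real.log (bigP D)) : ℂ) := by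
  rw [J1Bar]
  apply finsum_eq_sum_of_support_subset
  intro n hn
  rw [Function.mem_support] at hn
  rw [Finset.coe_range, Set.mem_Iio]
  by_contra hge
  rw [not_lt] at hge
  apply hn
  have h0 := ftilde_log_eq_zero_of_P1_lt D hD (P1_lt_of_Nsupp_le D hD hge) le_rfl
  rw [add_zero] at h0
  rw [h0]
  simp

omit [NeZero D] in
/-- `J₂(w,ψ̄)` is a finite sum over `n < ⌈PT⁻²⌉` (for `𝓛 ≥ 5`), as `J₂` is (`Skeleton.J2_eq_sum`).
[cite: Zhang2022LandauSiegel, §2 (2.30)] -/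
theorem J2Bar_eq_sum (hD : 5 ≤ Real.log D) (w : ℂ) :
    J2Bar χ x w = ∑ n ∈ Finset.range (Nsupp D),
      χ (n : ZMod D) * conj (x.ψ (n : ZMod x.p)) * (n : ℂ) ^ (-w) *
        (ftilde (Real.log n / Real.log (bigP D) + 0.004 - alphaTilde D) : ℂ) := by
  rw [J2Bar]
  apply finsum_eq_sum_of_support_subset
  intro n hn
  rw [Function.mem_support] at hn
  rw [Finset.coe_range, Set.mem_Iio]
  by_contra hge
  rw [not_lt] at hge
  apply hn
  rw [ftilde_log_shift_eq_zero_of_P1_lt D hD (P1_lt_of_Nsupp_le D (by linarith) hge)]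
  simp

omit [NeZero D] in
/-- **u001, unconditionally**: `conj J₁(s,ψ) = J₁(1−s,ψ̄)` on `σ = 1/2` for a real character `χ`
(`𝓛 ≥ 2`; `conj χ = χ`, `conj ψ = ψ̄`, `conj n⁻ˢ = n^{−(1−s)}`, `f̃` real). [cite: Zhang2022LandauSiegel, §10 p. 53, tex L2695] -/
theorem conj_J1_eq (hD : 2 ≤ Real.log D) (hq : χ.IsQuadratic) {s : ℂ} (hs : s.re = 1 / 2) :
    conj (J1 χ x s) = J1Bar χ x (1 - s) := by
  rw [J1_eq_sum χ x hD, J1Bar_eq_sum χ x hD, map_sum]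
  refine Finset.sum_congr rfl fun n _ => ?_
  have hn : conj ((n : ℂ) ^ (-s)) = (n : ℂ) ^ (-(1 - s)) := by
    rw [conj_natCast_cpow, map_neg, conj_eq_one_sub hs]
  simp only [pc, map_mul, hn, conj_apply_of_isQuadratic χ hq, Complex.conj_ofReal]
  ring

omit [NeZero D] in
/-- **u002, unconditionally**: `conj J₂(s,ψ) = J₂(1−s,ψ̄)` on `σ = 1/2` (`𝓛 ≥ 5`).
[cite: Zhang2022LandauSiegel, §10 p. 53, tex L2698] -/
theorem conj_J2_eq (hD : 5 ≤ Real.log D) (hq : χ.IsQuadratic) {s : ℂ} (hs : s.re = 1 / 2) :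
    conj (J2 χ x s) = J2Bar χ x (1 - s) := by
  rw [J2_eq_sum χ x hD, J2Bar_eq_sum χ x hD, map_sum]
  refine Finset.sum_congr rfl fun n _ => ?_
  have hn : conj ((n : ℂ) ^ (-s)) = (n : ℂ) ^ (-(1 - s)) := by
    rw [conj_natCast_cpow, map_neg, conj_eq_one_sub hs]
  simp only [pc, map_mul, hn, conj_apply_of_isQuadratic χ hq, Complex.conj_ofReal]
  ring

/-- **u001 holds** (node form, under the blanket (A), which is not used). [cite: Zhang2022LandauSiegel, §10 p. 53, tex L2695] -/
theorem step10u001_holds : Step10u001 := by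
  refine ⟨⌈Real.exp 5⌉₊, fun D _ χ hD hq _ _ x s hs => ?_⟩
  have hlog2 : 2 ≤ Real.log D := by linarith [five_le_log hD]
  exact conj_J1_eq χ x hlog2 hq hs

/-- `Step10u001` — `_holds` alias of `step10u001_holds` above under the fact's exact name (appended
2026-08-28, D-0026 bookkeeping: the proof term is the existing theorem of this file; no statement,
definition or attribute is edited; no new named fact; the ledger's debt table listed the fact
unproved). [cite: Zhang2022LandauSiegel, §10 p. 53, tex L2695] -/
theorem _root_.Literature.NumberTheory.LFunctions.Zhang2022.Typed.Sec10A.Step10u001_holds :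
    Step10u001 :=
  _root_.Literature.NumberTheory.LFunctions.Zhang2022.Typed.Sec10A.step10u001_holds

/-- **u002 holds** (node form). [cite: Zhang2022LandauSiegel, §10 p. 53, tex L2698] -/
theorem step10u002_holds : Step10u002 := by
  refine ⟨⌈Real.exp 5⌉₊, fun D _ χ hD hq _ _ x s hs => ?_⟩
  exact conj_J2_eq χ x (five_le_log hD) hq hs

/-- `Step10u002` — `_holds` alias of `step10u002_holds` above under the fact's exact name (appended
2026-08-28, D-0026 bookkeeping: the proof term is the existing theorem of this file; no statement,
definition or attribute is edited; no new named fact; the ledger's debt table listed the fact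
unproved). [cite: Zhang2022LandauSiegel, §10 p. 53, tex L2698] -/
theorem _root_.Literature.NumberTheory.LFunctions.Zhang2022.Typed.Sec10A.Step10u002_holds :
    Step10u002 :=
  _root_.Literature.NumberTheory.LFunctions.Zhang2022.Typed.Sec10A.step10u002_holds

end Reflections

/-! ### The two "By Lemma 8.1" displays and "Hence (10.1)" (edges) -/

section ByLemma81

variable (c' : ℝ)

/-- **u003 follows from Prop. 2.2 (i) and Lemma 8.1**: at the zeros `ρ ∈ 𝔷(ψ)` (on the critical line
by Prop. 2.2 (i)) `H₁(ρ,ψ)conj J₁(ρ,ψ) = A(𝐚₁₁;ρ,ψ)A(𝐚₁₃;1−ρ,ψ̄)` (`Skeleton.Apoly_a11_eq_H1`,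
`ApolyBar_a13_eq_conj_J1`), so the display is Lemma 8.1 at `(𝐚₁₁, 𝐚₁₃)` with `conj 𝐚₁₃ = 𝐚₁₃`,
`conj 𝐚₁₁ = 𝐚₂₁`. [cite: Zhang2022LandauSiegel, §10 p. 53, tex L2702] -/
theorem step10u003_of (h22 : Prop22i) (h81 : Lemma81 c') : Step10u003 c' := by
  intro ε hε
  set B : ℝ := 1 + ‖iota2‖ + ‖iota3‖ + ‖iota4‖ with hB
  obtain ⟨D₀, h⟩ := h22.and (h81 B ε hε)
  refine ⟨max D₀ ⌈Real.exp 5⌉₊, fun D _ χ hD hq hp hA => ?_⟩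
  have hlog5 : 5 ≤ Real.log D := five_le_log (le_trans (le_max_right _ _) hD)
  have hlog2 : 2 ≤ Real.log D := by linarith
  obtain ⟨h22', h81'⟩ := h D χ (le_trans (le_max_left _ _) hD) hq hp
  have hι2 := norm_nonneg iota2
  have hι3 := norm_nonneg iota3
  have hι4 := norm_nonneg iota4
  have k1 := h81' hA (a11 χ) (a13 χ) (adm72_mono (by rw [hB]; linarith) (adm72_a11 χ hlog2))
    (adm72_mono (by rw [hB]; linarith) (adm72_a13 χ hlog2))
  have e1 : (fun n => conj (a13 χ n)) = a13 χ := funext fun n => by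
    rw [a13, map_mul, conj_apply_of_isQuadratic χ hq, Complex.conj_ofReal]
  have e2 : (fun n => conj (a11 χ n)) = a21 χ := funext fun n => rfl
  rw [e1, e2] at k1
  have hl : lhs81 c' χ (a11 χ) (a13 χ) =
      ∑ i ∈ idx χ, cstar c' D i.1 i.2 * H1 χ i.1 i.2 * conj (J1 χ i.1 i.2) * omegaW D i.2 := by
    rw [lhs81]
    refine Finset.sum_congr rfl fun i hi => ?_
    have mem : i.1 ∈ PsiOne χ ∧ i.2 ∈ zeroSet D i.1 := by
      rw [idx, Finset.mem_sigma] at hi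
      exact ⟨mem_of_mem_finsetOf hi.1, mem_of_mem_finsetOf hi.2⟩
    have hre : i.2.re = 1 / 2 :=
      h22' i.1 mem.1 i.2 (mem_prodZeroSetOmega_of_mem_zeroSet χ mem.2)
    rw [Apoly_a11_eq_H1 χ i.1 hlog2, ApolyBar_a13_eq_conj_J1 χ i.1 hlog2 hq hre]
  rw [← hl]
  exact k1

/-- **u005 follows from Prop. 2.2 (i) and Lemma 8.1** (at `(𝐚₁₄, 𝐚₂₂)`: `conj H₂(ρ,ψ)J₂(ρ,ψ) =
A(𝐚₁₄;ρ,ψ)A(𝐚₂₂;1−ρ,ψ̄)`, `conj 𝐚₂₂ = 𝐚₁₂`, `conj 𝐚₁₄ = 𝐚₁₄`).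
[cite: Zhang2022LandauSiegel, §10 p. 53, tex L2710] -/
theorem step10u005_of (h22 : Prop22i) (h81 : Lemma81 c') : Step10u005 c' := by
  intro ε hε
  set B : ℝ := 1 + ‖iota2‖ + ‖iota3‖ + ‖iota4‖ with hB
  obtain ⟨D₀, h⟩ := h22.and (h81 B ε hε)
  refine ⟨max D₀ ⌈Real.exp 5⌉₊, fun D _ χ hD hq hp hA => ?_⟩
  have hlog5 : 5 ≤ Real.log D := five_le_log (le_trans (le_max_right _ _) hD)
  have hlog2 : 2 ≤ Real.log D := by linarith
  obtain ⟨h22', h81'⟩ := h D χ (le_trans (le_max_left _ _) hD) hq hp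
  have hι2 := norm_nonneg iota2
  have hι3 := norm_nonneg iota3
  have hι4 := norm_nonneg iota4
  have k2 := h81' hA (a14 χ) (a22 χ) (adm72_mono (by rw [hB]; linarith) (adm72_a14 χ hlog5))
    (adm72_mono (by rw [hB]; linarith) (adm72_a22 χ hlog2))
  have e3 : (fun n => conj (a22 χ n)) = a12 χ := funext fun n => by rw [a22, Complex.conj_conj]
  have e4 : (fun n => conj (a14 χ n)) = a14 χ := funext fun n => by
    rw [a14, map_mul, conj_apply_of_isQuadratic χ hq, Complex.conj_ofReal]
  rw [e3, e4] at k2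
  have hl : lhs81 c' χ (a14 χ) (a22 χ) =
      ∑ i ∈ idx χ, cstar c' D i.1 i.2 * conj (H2 χ i.1 i.2) * J2 χ i.1 i.2 * omegaW D i.2 := by
    rw [lhs81]
    refine Finset.sum_congr rfl fun i hi => ?_
    have mem : i.1 ∈ PsiOne χ ∧ i.2 ∈ zeroSet D i.1 := by
      rw [idx, Finset.mem_sigma] at hi
      exact ⟨mem_of_mem_finsetOf hi.1, mem_of_mem_finsetOf hi.2⟩
    have hre : i.2.re = 1 / 2 :=
      h22' i.1 mem.1 i.2 (mem_prodZeroSetOmega_of_mem_zeroSet χ mem.2)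
    rw [Apoly_a14_eq_J2 χ i.1 hlog5, ApolyBar_a22_eq_conj_H2 χ i.1 hlog2 hq hre]
    ring
  rw [← hl]
  exact k2

/-- **"Hence (10.1)"** (p. 53, tex L2715–L2718): the two displays u003, u005 add up to
`Skeleton.Eq101` — `Ξ₁*` (2.17) IS the sum of their left sides, term by term.
[cite: Zhang2022LandauSiegel, §10 (10.1), p. 53] -/
theorem eq101_of_steps (h3 : Step10u003 c') (h5 : Step10u005 c') : Eq101 c' := by
  intro ε hε
  have hε2 : 0 < ε / 2 := by positivity
  obtain ⟨D₀, h⟩ := (h3 (ε / 2) hε2).and (h5 (ε / 2) hε2)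
  refine ⟨D₀, fun D _ χ hD hq hp hA => ?_⟩
  obtain ⟨k1, k2⟩ := h D χ hD hq hp
  have hsplit : xiStar1 c' χ =
      (∑ i ∈ idx χ, cstar c' D i.1 i.2 * H1 χ i.1 i.2 * conj (J1 χ i.1 i.2) * omegaW D i.2) +
        ∑ i ∈ idx χ, cstar c' D i.1 i.2 * conj (H2 χ i.1 i.2) * J2 χ i.1 i.2 * omegaW D i.2 := by
    rw [xiStar1, ← Finset.sum_add_distrib]
    refine Finset.sum_congr rfl fun i _ => ?_
    ring
  have halg : xiStar1 c' χ - (Theta1 c' χ (a11 χ) (a13 χ) + conj (Theta1 c' χ (a13 χ) (a21 χ)) +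
        Theta1 c' χ (a14 χ) (a22 χ) + conj (Theta1 c' χ (a12 χ) (a14 χ))) =
      ((∑ i ∈ idx χ, cstar c' D i.1 i.2 * H1 χ i.1 i.2 * conj (J1 χ i.1 i.2) * omegaW D i.2) -
          (Theta1 c' χ (a11 χ) (a13 χ) + conj (Theta1 c' χ (a13 χ) (a21 χ)))) +
        ((∑ i ∈ idx χ, cstar c' D i.1 i.2 * conj (H2 χ i.1 i.2) * J2 χ i.1 i.2 * omegaW D i.2) -
          (Theta1 c' χ (a14 χ) (a22 χ) + conj (Theta1 c' χ (a12 χ) (a14 χ)))) := by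
    rw [hsplit]; ring
  rw [halg]
  refine (norm_add_le _ _).trans ?_
  linarith [k1 hA, k2 hA]

end ByLemma81

/-! ### The residue of Lemma 10.1 (u011, proved from `Section10MainTerms`) -/

section Residue

variable (c' : ℝ)

/-- For real `b, y > 0`: `bˢ/yˢ = e^{s log(b/y)}` (principal powers of positive reals).
[cite: Zhang2022LandauSiegel, §10 (10.6)] -/
private theorem cpow_div_cpow_ofReal {b y : ℝ} (hb : 0 < b) (hy : 0 < y) (s : ℂ) :
    (b : ℂ) ^ s / (y : ℂ) ^ s = cexp (s * (Real.log (b / y) : ℂ)) := by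
  rw [Complex.cpow_def_of_ne_zero (by exact_mod_cast hb.ne'),
    Complex.cpow_def_of_ne_zero (by exact_mod_cast hy.ne'), ← Complex.exp_sub,
    ← Complex.ofReal_log hb.le, ← Complex.ofReal_log hy.le, Real.log_div hb.ne' hy.ne']
  push_cast
  ring_nf

/-- `P^θ = e^{θ𝓛⁹}` is the tree's `Ppow (log P) θ`. [cite: Zhang2022LandauSiegel, §2 (2.6)] -/
private theorem bigP_rpow_eq_Ppow (D : ℕ) (θ : ℝ) : bigP D ^ θ = Ppow (ell D ^ 9) θ := by
  rw [Ppow, bigP, ← Real.exp_mul]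

/-- **u011, unconditionally**: the residue at `0` of `((P′₁)ˢ − 2(P′₂)ˢ) y⁻ˢ (s − β_j)/s²` is
`−1 − β_j log(y/P^{0.5})` — the tree's `lemma101_range2` (Cauchy's formula for the entire numerator
`e^{sL_A} − 2e^{sL_B}`, `L_A − 2L_B = log(y/P^{0.5})`), on every circle around `0`; any `D`, `j`, `c′`.
[cite: Zhang2022LandauSiegel, §10 p. 54, tex L2772] -/
theorem residue101_eq (D j : ℕ) {y : ℝ} (hy : 0 < y) {r : ℝ} (hr : 0 < r) :
    (2 * π * I)⁻¹ * (∮ s in C(0, r),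
        ((Pp1 D : ℂ) ^ s - 2 * (Pp2 D : ℂ) ^ s) / (y : ℂ) ^ s * (s - betaJ c' D j) / s ^ 2) =
      -1 - betaJ c' D j * (Real.log (y / bigP D ^ (0.5 : ℝ)) : ℂ) := by
  have h1 : 0 < Pp1 D := Real.rpow_pos_of_pos (Real.exp_pos _) _
  have h2 : 0 < Pp2 D := Real.rpow_pos_of_pos (Real.exp_pos _) _
  have h0 : (0 : ℂ) ∈ ball (0 : ℂ) r := mem_ball_self hr
  have hP1 : Ppow (ell D ^ 9) 0.504 = Pp1 D := (bigP_rpow_eq_Ppow D 0.504).symm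
  have hP2 : Ppow (ell D ^ 9) 0.502 = Pp2 D := (bigP_rpow_eq_Ppow D 0.502).symm
  have hP3 : Ppow (ell D ^ 9) 0.5 = bigP D ^ (0.5 : ℝ) := (bigP_rpow_eq_Ppow D 0.5).symm
  have key := lemma101_range2 (betaJ c' D j) (Λ := ell D ^ 9) hy h0
  rw [hP1, hP2, hP3] at key
  have hnum : ∀ s : ℂ, ((Pp1 D : ℂ) ^ s - 2 * (Pp2 D : ℂ) ^ s) / (y : ℂ) ^ s =
      texp2 (Real.log (Pp1 D / y)) (Real.log (Pp2 D / y)) s := by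
    intro s
    rw [texp2, sub_div, mul_div_assoc, cpow_div_cpow_ofReal h1 hy, cpow_div_cpow_ofReal h2 hy]
  have hfun : (fun s : ℂ =>
      ((Pp1 D : ℂ) ^ s - 2 * (Pp2 D : ℂ) ^ s) / (y : ℂ) ^ s * (s - betaJ c' D j) / s ^ 2) =
      fun s => texp2 (Real.log (Pp1 D / y)) (Real.log (Pp2 D / y)) s
        * (s - betaJ c' D j) / s ^ 2 := by
    funext s
    rw [hnum s]
  rw [hfun]
  exact key

/-- **u011 holds** (node form, under the blanket (A), which is not used). [cite: Zhang2022LandauSiegel, §10 p. 54, tex L2772] -/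
theorem step10u011_holds : Step10u011 c' :=
  ⟨0, fun D _ _ _ _ _ _ j _ _ hy _ hr => residue101_eq c' D j hy hr⟩

/-- `Step10u011` — `_holds` alias of `step10u011_holds` above under the fact's exact name (appended
2026-08-28, D-0026 bookkeeping: the proof term is the existing theorem of this file; no statement,
definition or attribute is edited; no new named fact; the ledger's debt table listed the fact
unproved). [cite: Zhang2022LandauSiegel, §10 p. 54, tex L2772] -/
theorem _root_.Literature.NumberTheory.LFunctions.Zhang2022.Typed.Sec10A.Step10u011_holds :
    Step10u011 c' :=
  _root_.Literature.NumberTheory.LFunctions.Zhang2022.Typed.Sec10A.step10u011_holds (c' := c')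

end Residue


/-! ## Wave 2a (theorem-only append): "This yields (10.3)" as a kernel edge, Lemma 10.1 from its
displayed steps modulo the undisplayed ranges, and u020 (removable singularity) discharged -/

section Yields

variable (c' : ℝ)

/-- `α = π/𝓛⁹ > 0` once `D ≥ 2`. [cite: Zhang2022LandauSiegel, §2 (2.10)] -/
private theorem alpha_pos_of_two_le {D : ℕ} (hD : 2 ≤ D) : 0 < alpha D := by
  have hlog : 0 < Real.log D := Real.log_pos (by exact_mod_cast hD)
  rw [alpha, log_bigP]
  exact div_pos Real.pi_pos (pow_pos hlog 9)

/-- **"The[!] yields (10.3)"** (p. 54): (10.7) + the contour shift with Lemma 5.8 (u010) + the residue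
(u011) give (10.3) — kernel-checked edge (the `o(𝓛⁻¹⁵)` of u010 taken at `ε = 1` is (10.3)'s
`O(𝓛⁻¹⁵)`). [cite: Zhang2022LandauSiegel, §10 (10.3), p. 54, tex L2762–L2775] -/
theorem eq103_of_steps (h107 : Eq107 c') (h10 : Step10u010 c') (h11 : Step10u011 c') :
    Eq103 c' := by
  refine ⟨1, ?_⟩
  obtain ⟨D₀, h⟩ := h107.and ((h10 1 one_pos).and h11)
  refine ⟨max D₀ 2, fun D _ χ hD hq hp hA j hj y hy1 hy2 => ?_⟩
  obtain ⟨k107, k10, k11⟩ := h D χ (le_trans (le_max_left _ _) hD) hq hp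
  have hD2 : 2 ≤ D := le_trans (le_max_right _ _) hD
  have hα : 0 < 5 * alpha D := by linarith [alpha_pos_of_two_le hD2]
  have hy0 : 0 < y := lt_trans (Real.rpow_pos_of_pos (Real.exp_pos _) _) hy1
  have key := k10 hA j hj y hy1 hy2
  rw [← k107 hA j hj y hy1 hy2, k11 hA j hj y hy0 (5 * alpha D) hα] at key
  simpa only [one_mul] using key

/-- **Lemma 10.1 from its displayed steps, modulo (10.2), (10.4), (10.5)** (which have no displayed
step): (10.7), u010, u011 supply (10.3). [cite: Zhang2022LandauSiegel, §10 Lemma 10.1 (proof), pp. 54–55] -/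
theorem lemma101_of_steps (h102 : Eq102 c') (h107 : Eq107 c') (h10 : Step10u010 c')
    (h11 : Step10u011 c') (h104 : Eq104 c') (h105 : Eq105 c') : Lemma101 c' :=
  (lemma101_iff_eqs c').mpr ⟨h102, eq103_of_steps c' h107 h10 h11, h104, h105⟩

end Yields

/-! ### u020: the removable singularity of `((P′₁)ˢ − 2(P′₂)ˢ + (P′₃)ˢ)/s²` (discharged) -/

section RemovableSingularity

/-- For real `b > 0`: `bˢ = e^{s log b}` is the tree's `texp1 (log b) s`. [cite: Zhang2022LandauSiegel, §10 (10.4)] -/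
private theorem cpow_ofReal_eq_texp1 {b : ℝ} (hb : 0 < b) (s : ℂ) :
    (b : ℂ) ^ s = texp1 (Real.log b) s := by
  rw [texp1, Complex.cpow_def_of_ne_zero (by exact_mod_cast hb.ne'), ← Complex.ofReal_log hb.le,
    mul_comm]

/-- `dslope` of an entire function is entire (power series at the base point). [folklore] -/
private theorem differentiable_dslope {f : ℂ → ℂ} (hf : Differentiable ℂ f) (a : ℂ) :
    Differentiable ℂ (dslope f a) := by
  intro z
  by_cases hz : z = a
  · subst hz
    obtain ⟨p, hp⟩ := hf.analyticAt z
    exact (hp.has_fpower_series_dslope_fslope).analyticAt.differentiableAt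
  · exact (differentiableAt_dslope_of_ne hz).mpr (hf z)

/-- **u020 holds**: with `N(s) = (P′₁)ˢ − 2(P′₂)ˢ + (P′₃)ˢ = e^{sA} − 2e^{sB} + e^{sC}` (tree `texp3`,
`A, B, C = 0.504, 0.502, 0.5 × log P`), `N(0) = 0` and `N′(0) = A − 2B + C = 0`, so
`g := dslope (dslope N 0) 0` is entire, equals `N(s)/s²` off `0`, and
`g(0) = N″(0)/2 = (A² − 2B² + C²)/2 = (log P/500)²` (tree `deriv_deriv_texp3`,
`Literature.Analysis.Complex.iterate_dslope_apply_eq_iteratedDeriv_div`). The blanket (A) is not used.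
[cite: Zhang2022LandauSiegel, §10 p. 56, tex L2836] -/
theorem step10u020_holds : Step10u020 := by
  refine ⟨0, fun D _ χ _ _ _ _ => ?_⟩
  have hP : 0 < bigP D := Real.exp_pos _
  have h1 : 0 < Pp1 D := Real.rpow_pos_of_pos hP _
  have h2 : 0 < Pp2 D := Real.rpow_pos_of_pos hP _
  have h3 : 0 < Pp3 D := Real.rpow_pos_of_pos hP _
  set A : ℂ := (Real.log (Pp1 D) : ℂ) with hA
  set B : ℂ := (Real.log (Pp2 D) : ℂ) with hB
  set C : ℂ := (Real.log (Pp3 D) : ℂ) with hC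
  set N : ℂ → ℂ := texp3 A B C with hN
  have hNd : Differentiable ℂ N := differentiable_texp3 A B C
  have hA' : Real.log (Pp1 D) = 0.504 * Real.log (bigP D) := by rw [Pp1, Real.log_rpow hP]
  have hB' : Real.log (Pp2 D) = 0.502 * Real.log (bigP D) := by rw [Pp2, Real.log_rpow hP]
  have hC' : Real.log (Pp3 D) = 0.5 * Real.log (bigP D) := by rw [Pp3, Real.log_rpow hP]
  have hlin : A - 2 * B + C = 0 := by
    rw [hA, hB, hC, hA', hB', hC']; push_cast; ring
  have hsq : (A ^ 2 - 2 * B ^ 2 + C ^ 2) / 2 = (((Real.log (bigP D) / 500) ^ 2 : ℝ) : ℂ) := by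
    rw [hA, hB, hC, hA', hB', hC']; push_cast; ring
  have hNum : ∀ s : ℂ, (Pp1 D : ℂ) ^ s - 2 * (Pp2 D : ℂ) ^ s + (Pp3 D : ℂ) ^ s = N s := by
    intro s
    rw [hN, texp3, cpow_ofReal_eq_texp1 h1, cpow_ofReal_eq_texp1 h2, cpow_ofReal_eq_texp1 h3]
    rfl
  have hN0 : N 0 = 0 := by rw [hN, texp3]; simp; norm_num
  have hN1 : deriv N 0 = 0 := by
    rw [hN, deriv_texp3]
    simp only [zero_mul, Complex.exp_zero, mul_one]
    linear_combination hlin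
  refine ⟨dslope (dslope N 0) 0, differentiable_dslope (differentiable_dslope hNd 0) 0, ?_, ?_⟩
  · intro s hs
    rw [dslope_of_ne _ hs, slope_def_field, dslope_of_ne _ hs, slope_def_field, dslope_same, hN0, hN1,
      ← hNum s]
    field_simp
    ring
  · have key := Literature.Analysis.Complex.iterate_dslope_apply_eq_iteratedDeriv_div
      (f := N) (ρ := 0) Filter.univ_mem hNd.differentiableOn 2
    have hit : (Function.swap dslope (0 : ℂ))^[2] N = dslope (dslope N 0) 0 := by
      simp [Function.iterate_succ, Function.comp, Function.swap]
    rw [hit] at key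
    rw [key]
    have hd2 : iteratedDeriv 2 N = deriv (deriv N) := by
      rw [show (2 : ℕ) = 1 + 1 from rfl, iteratedDeriv_succ, iteratedDeriv_one]
    rw [hd2, hN, deriv_deriv_texp3, ← hsq]
    norm_num [Nat.factorial]

/-- `Step10u020` — `_holds` alias of `step10u020_holds` above under the fact's exact name (appended
2026-08-28, D-0026 bookkeeping: the proof term is the existing theorem of this file; no statement,
definition or attribute is edited; no new named fact; the ledger's debt table listed the fact
unproved). [cite: Zhang2022LandauSiegel, §10 p. 56, tex L2836] -/
theorem _root_.Literature.NumberTheory.LFunctions.Zhang2022.Typed.Sec10A.Step10u020_holds :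
    Step10u020 :=
  _root_.Literature.NumberTheory.LFunctions.Zhang2022.Typed.Sec10A.step10u020_holds

end RemovableSingularity

/-! ## Wave 2b (theorem-only append): "This yields (10.8)", "These yield (10.9) and (10.10)" as kernel
edges, and Lemma 10.2 from its displayed steps modulo (10.11) -/

section YieldsB

variable (c' : ℝ)

/-- `log P = 𝓛⁹ ≠ 0` once `D ≥ 2`. [cite: Zhang2022LandauSiegel, §2 (2.6)] -/
private theorem log_bigP_ne_zero {D : ℕ} (hD : 2 ≤ D) : Real.log (bigP D) ≠ 0 := by
  have hlog : 0 < Real.log D := Real.log_pos (by exact_mod_cast hD)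
  rw [log_bigP]
  exact (pow_pos hlog 9).ne'

/-- For real `b, y > 0`: the three-term numerator over `yˢ` is the tree's `texp3` at the logs.
[cite: Zhang2022LandauSiegel, §10 (10.6)] -/
private theorem num3_div_eq_texp3 (D : ℕ) {y : ℝ} (hy : 0 < y) (s : ℂ) :
    ((Pp1 D : ℂ) ^ s - 2 * (Pp2 D : ℂ) ^ s + (Pp3 D : ℂ) ^ s) / (y : ℂ) ^ s =
      texp3 (Real.log (Pp1 D / y)) (Real.log (Pp2 D / y)) (Real.log (Pp3 D / y)) s := by
  have h1 : 0 < Pp1 D := Real.rpow_pos_of_pos (Real.exp_pos _) _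
  have h2 : 0 < Pp2 D := Real.rpow_pos_of_pos (Real.exp_pos _) _
  have h3 : 0 < Pp3 D := Real.rpow_pos_of_pos (Real.exp_pos _) _
  rw [texp3, add_div, sub_div, mul_div_assoc, cpow_div_cpow_ofReal h1 hy, cpow_div_cpow_ofReal h2 hy,
    cpow_div_cpow_ofReal h3 hy]

/-- For real `b, y > 0`: the two-term numerator over `yˢ` is `texp2`. [cite: Zhang2022LandauSiegel, §10 (10.7)] -/
private theorem num2_div_eq_texp2 (D : ℕ) {y : ℝ} (hy : 0 < y) (s : ℂ) :
    ((Pp1 D : ℂ) ^ s - 2 * (Pp2 D : ℂ) ^ s) / (y : ℂ) ^ s =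
      texp2 (Real.log (Pp1 D / y)) (Real.log (Pp2 D / y)) s := by
  have h1 : 0 < Pp1 D := Real.rpow_pos_of_pos (Real.exp_pos _) _
  have h2 : 0 < Pp2 D := Real.rpow_pos_of_pos (Real.exp_pos _) _
  rw [texp2, sub_div, mul_div_assoc, cpow_div_cpow_ofReal h1 hy, cpow_div_cpow_ofReal h2 hy]

/-- The residue behind (10.8), in the manuscript's variables: on any circle around `0`,
`(2πi)⁻¹∮ (β_{j+1}+s)(β_{j+2}+s)s⁻¹ ((P′₁)ˢ − 2(P′₂)ˢ + (P′₃)ˢ)(dr)⁻ˢ s⁻² ds = β_{j+1}β_{j+2}(log P/500)²`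
(tree `lemma102_range1`, `tent_sq3`). [cite: Zhang2022LandauSiegel, §10 (10.8), p. 56, tex L2831–L2839] -/
theorem residue102a_eq (D j : ℕ) {y : ℝ} (hy : 0 < y) {ρ : ℝ} (hρ : 0 < ρ) :
    (2 * π * I)⁻¹ * (∮ s in C(0, ρ),
        (betaJ c' D (j + 1) + s) * (betaJ c' D (j + 2) + s) / s *
          (((Pp1 D : ℂ) ^ s - 2 * (Pp2 D : ℂ) ^ s + (Pp3 D : ℂ) ^ s) / (y : ℂ) ^ s) / s ^ 2) =
      betaJ c' D (j + 1) * betaJ c' D (j + 2) *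
        (((Real.log (bigP D) / 500) ^ 2 : ℝ) : ℂ) := by
  have h0 : (0 : ℂ) ∈ ball (0 : ℂ) ρ := mem_ball_self hρ
  have hP1 : Ppow (ell D ^ 9) 0.504 = Pp1 D := (bigP_rpow_eq_Ppow D 0.504).symm
  have hP2 : Ppow (ell D ^ 9) 0.502 = Pp2 D := (bigP_rpow_eq_Ppow D 0.502).symm
  have hP3 : Ppow (ell D ^ 9) 0.5 = Pp3 D := (bigP_rpow_eq_Ppow D 0.5).symm
  have key := lemma102_range1 (betaJ c' D (j + 1)) (betaJ c' D (j + 2)) (Λ := ell D ^ 9) hy h0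
  rw [hP1, hP2, hP3] at key
  have hfun : (fun s : ℂ => (betaJ c' D (j + 1) + s) * (betaJ c' D (j + 2) + s) / s *
        (((Pp1 D : ℂ) ^ s - 2 * (Pp2 D : ℂ) ^ s + (Pp3 D : ℂ) ^ s) / (y : ℂ) ^ s) / s ^ 2) =
      fun s => (betaJ c' D (j + 1) + s) * (betaJ c' D (j + 2) + s) / s *
        texp3 (Real.log (Pp1 D / y)) (Real.log (Pp2 D / y)) (Real.log (Pp3 D / y)) s / s ^ 2 := by
    funext s
    rw [num3_div_eq_texp3 D hy s]
  rw [hfun, key, log_bigP]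

/-- The residue behind (10.9): `… = −1 + 𝔶₁ⱼ(y)` (tree `lemma102_range2`; `Skeleton.fraky1` is the tree's
`yfrak1` at the skeleton's shifts). [cite: Zhang2022LandauSiegel, §10 (10.9), p. 56, tex L2842] -/
theorem residue102b_eq (D j : ℕ) {y : ℝ} (hy : 0 < y) {ρ : ℝ} (hρ : 0 < ρ) :
    (2 * π * I)⁻¹ * (∮ s in C(0, ρ),
        (betaJ c' D (j + 1) + s) * (betaJ c' D (j + 2) + s) / s *
          (((Pp1 D : ℂ) ^ s - 2 * (Pp2 D : ℂ) ^ s) / (y : ℂ) ^ s) / s ^ 2) =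
      -1 + fraky1 c' D j y := by
  have h0 : (0 : ℂ) ∈ ball (0 : ℂ) ρ := mem_ball_self hρ
  have hP1 : Ppow (ell D ^ 9) 0.504 = Pp1 D := (bigP_rpow_eq_Ppow D 0.504).symm
  have hP2 : Ppow (ell D ^ 9) 0.502 = Pp2 D := (bigP_rpow_eq_Ppow D 0.502).symm
  have key := lemma102_range2 (betaJ c' D (j + 1)) (betaJ c' D (j + 2)) (Λ := ell D ^ 9) hy h0
  rw [hP1, hP2] at key
  have hfun : (fun s : ℂ => (betaJ c' D (j + 1) + s) * (betaJ c' D (j + 2) + s) / s *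
        (((Pp1 D : ℂ) ^ s - 2 * (Pp2 D : ℂ) ^ s) / (y : ℂ) ^ s) / s ^ 2) =
      fun s => (betaJ c' D (j + 1) + s) * (betaJ c' D (j + 2) + s) / s *
        texp2 (Real.log (Pp1 D / y)) (Real.log (Pp2 D / y)) s / s ^ 2 := by
    funext s
    rw [num2_div_eq_texp2 D hy s]
  have hy1 : yfrak1 (betaJ c' D (j + 1)) (betaJ c' D (j + 2)) (ell D ^ 9) y = fraky1 c' D j y := by
    rw [yfrak1, fraky1, ← bigP_rpow_eq_Ppow, ← bigP_rpow_eq_Ppow, ← bigP_rpow_eq_Ppow]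
    push_cast
    ring
  rw [hfun, key, hy1]

/-- The residue behind (10.10): `… = 1 + 𝔶₂ⱼ(y)` (tree `lemma102_range3`).
[cite: Zhang2022LandauSiegel, §10 (10.10), p. 56, tex L2847] -/
theorem residue102c_eq (D j : ℕ) {y : ℝ} (hy : 0 < y) {ρ : ℝ} (hρ : 0 < ρ) :
    (2 * π * I)⁻¹ * (∮ s in C(0, ρ),
        (betaJ c' D (j + 1) + s) * (betaJ c' D (j + 2) + s) / s *
          ((Pp1 D / y : ℝ) : ℂ) ^ s / s ^ 2) =
      1 + fraky2 c' D j y := by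
  have h0 : (0 : ℂ) ∈ ball (0 : ℂ) ρ := mem_ball_self hρ
  have h1 : 0 < Pp1 D / y := div_pos (Real.rpow_pos_of_pos (Real.exp_pos _) _) hy
  have hP1 : Ppow (ell D ^ 9) 0.504 = Pp1 D := (bigP_rpow_eq_Ppow D 0.504).symm
  have key := lemma102_range3 (betaJ c' D (j + 1)) (betaJ c' D (j + 2)) (ell D ^ 9) y h0
  rw [hP1] at key
  have hfun : (fun s : ℂ => (betaJ c' D (j + 1) + s) * (betaJ c' D (j + 2) + s) / s *
        ((Pp1 D / y : ℝ) : ℂ) ^ s / s ^ 2) =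
      fun s => (betaJ c' D (j + 1) + s) * (betaJ c' D (j + 2) + s) / s *
        texp1 (Real.log (Pp1 D / y)) s / s ^ 2 := by
    funext s
    rw [cpow_ofReal_eq_texp1 h1 s]
  have hy2 : yfrak2 (betaJ c' D (j + 1)) (betaJ c' D (j + 2)) (ell D ^ 9) y = fraky2 c' D j y := by
    rw [yfrak2, fraky2, ← bigP_rpow_eq_Ppow]
    push_cast
    ring
  rw [hfun, key, hy2]

/-- **"This yields (10.8)"** (p. 56): u019 + the residue value give (10.8) — kernel-checked edge
(`(500/log P)·β_{j+1}β_{j+2}(log P/500)² = β_{j+1}β_{j+2} log P/500`, tree `prefactor_108`).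
[cite: Zhang2022LandauSiegel, §10 (10.8), p. 56, tex L2835–L2839] -/
theorem eq108_of_step19 (h19 : Step10u019 c') : Eq108 c' := by
  obtain ⟨C, hF⟩ := h19
  obtain ⟨D₀, h⟩ := hF
  refine ⟨C, max D₀ 2, fun D _ χ hD hq hp hA j hj d r hd hr hdr => ?_⟩
  have k := h D χ (le_trans (le_max_left _ _) hD) hq hp hA j hj d r hd hr hdr
  have hD2 : 2 ≤ D := le_trans (le_max_right _ _) hD
  have hα : 0 < 10 * alpha D := by linarith [alpha_pos_of_two_le hD2]
  have hy : (0 : ℝ) < ((d * r : ℕ) : ℝ) := by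
    have : 1 ≤ d * r := Nat.one_le_iff_ne_zero.mpr (Nat.mul_ne_zero (by omega) (by omega))
    exact_mod_cast this
  have hdr' : ((d * r : ℕ) : ℂ) = (((d * r : ℕ) : ℝ) : ℂ) := (Complex.ofReal_natCast _).symm
  rw [hdr', residue102a_eq c' D j hy hα] at k
  have hΛ : (Real.log (bigP D) : ℂ) ≠ 0 := by exact_mod_cast log_bigP_ne_zero hD2
  have halg : (500 : ℂ) * deriv χ.LFunction 1 * PiW χ d r / (Real.log (bigP D) : ℂ) *
        (betaJ c' D (j + 1) * betaJ c' D (j + 2) * (((Real.log (bigP D) / 500) ^ 2 : ℝ) : ℂ)) =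
      deriv χ.LFunction 1 * PiW χ d r / 500 * (betaJ c' D (j + 1) * betaJ c' D (j + 2)) *
        Real.log (bigP D) := by
    push_cast
    field_simp
  rw [halg] at k
  exact k

/-- **"These yield (10.9) …"** (p. 56): u021 (on (10.9)'s range) + the residue value give (10.9) —
kernel-checked edge. [cite: Zhang2022LandauSiegel, §10 (10.9), p. 56, tex L2841–L2851] -/
theorem eq109_of_step21r (h21 : Step10u021r c') : Eq109 c' := by
  obtain ⟨C, hF⟩ := h21
  obtain ⟨D₀, h⟩ := hF
  refine ⟨C, max D₀ 2, fun D _ χ hD hq hp hA j hj d r hd hr h1 h2 => ?_⟩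
  have k := h D χ (le_trans (le_max_left _ _) hD) hq hp hA j hj d r hd hr h1 h2
  have hD2 : 2 ≤ D := le_trans (le_max_right _ _) hD
  have hα : 0 < 10 * alpha D := by linarith [alpha_pos_of_two_le hD2]
  have hy : (0 : ℝ) < ((d * r : ℕ) : ℝ) := by
    have : 1 ≤ d * r := Nat.one_le_iff_ne_zero.mpr (Nat.mul_ne_zero (by omega) (by omega))
    exact_mod_cast this
  have hdr' : ((d * r : ℕ) : ℂ) = (((d * r : ℕ) : ℝ) : ℂ) := (Complex.ofReal_natCast _).symm
  rw [hdr', residue102b_eq c' D j hy hα] at k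
  exact k

/-- **"These yield … (10.10)"** (p. 56): u022 + the residue value give (10.10) — kernel-checked edge.
[cite: Zhang2022LandauSiegel, §10 (10.10), p. 56, tex L2846–L2851] -/
theorem eq1010_of_step22 (h22 : Step10u022 c') : Eq1010 c' := by
  obtain ⟨C, hF⟩ := h22
  obtain ⟨D₀, h⟩ := hF
  refine ⟨C, max D₀ 2, fun D _ χ hD hq hp hA j hj d r hd hr h1 h2 => ?_⟩
  have k := h D χ (le_trans (le_max_left _ _) hD) hq hp hA j hj d r hd hr h1 h2
  have hD2 : 2 ≤ D := le_trans (le_max_right _ _) hD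
  have hα : 0 < 10 * alpha D := by linarith [alpha_pos_of_two_le hD2]
  have hy : (0 : ℝ) < ((d * r : ℕ) : ℝ) := by
    have : 1 ≤ d * r := Nat.one_le_iff_ne_zero.mpr (Nat.mul_ne_zero (by omega) (by omega))
    exact_mod_cast this
  rw [residue102c_eq c' D j hy hα] at k
  exact k

/-- **Lemma 10.2 from its displayed steps, modulo (10.11)**: u019, u021 (on (10.9)'s range), u022 and
(10.11) imply the banked node `Skeleton.Lemma102 c'` (kernel-checked; (10.11) — "similar to (10.5)" —
has no displayed step). [cite: Zhang2022LandauSiegel, §10 Lemma 10.2 (proof), pp. 55–56] -/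
theorem lemma102_of_steps (h19 : Step10u019 c') (h21 : Step10u021r c') (h22 : Step10u022 c')
    (h1011 : Eq1011 c') : Lemma102 c' :=
  (lemma102_iff_eqs c').mpr ⟨eq108_of_step19 c' h19, eq109_of_step21r c' h21,
    eq1010_of_step22 c' h22, h1011⟩

end YieldsB

/-! ### The other two Lemma-10.1 residues in the manuscript's variables (helpers for (10.4), (10.2)) -/

section Residues101

variable (c' : ℝ)

/-- The residue behind **(10.4)** ("in a way similar to the proof of (10.3)", p. 54): on any circle
around `0`, `(2πi)⁻¹∮ (P′₁/y)ˢ (s − β_j) s⁻² ds = 1 − β_j log(P^{0.504}/y)` (tree `lemma101_range3`).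
[cite: Zhang2022LandauSiegel, §10 (10.4), p. 54, tex L2777–L2782] -/
theorem residue104_eq (D j : ℕ) {y : ℝ} (hy : 0 < y) {r : ℝ} (hr : 0 < r) :
    (2 * π * I)⁻¹ * (∮ s in C(0, r), ((Pp1 D / y : ℝ) : ℂ) ^ s * (s - betaJ c' D j) / s ^ 2) =
      1 - betaJ c' D j * (Real.log (bigP D ^ (0.504 : ℝ) / y) : ℂ) := by
  have h0 : (0 : ℂ) ∈ ball (0 : ℂ) r := mem_ball_self hr
  have h1 : 0 < Pp1 D / y := div_pos (Real.rpow_pos_of_pos (Real.exp_pos _) _) hy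
  have hP1 : Ppow (ell D ^ 9) 0.504 = Pp1 D := (bigP_rpow_eq_Ppow D 0.504).symm
  have key := lemma101_range3 (betaJ c' D j) (ell D ^ 9) y h0
  rw [hP1] at key
  have hfun : (fun s : ℂ => ((Pp1 D / y : ℝ) : ℂ) ^ s * (s - betaJ c' D j) / s ^ 2) =
      fun s => texp1 (Real.log (Pp1 D / y)) s * (s - betaJ c' D j) / s ^ 2 := by
    funext s
    rw [cpow_ofReal_eq_texp1 h1 s]
  rw [hfun, key]
  rfl

/-- The residue with all three terms VANISHES (consistency of (10.6) with (10.2): for `y ≤ P^{0.5}`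
the tent is `0`): `(2πi)⁻¹∮ ((P′₁)ˢ − 2(P′₂)ˢ + (P′₃)ˢ) y⁻ˢ (s − β_j) s⁻² ds = 0` (tree `lemma101_range1`).
[cite: Zhang2022LandauSiegel, §10 (10.2), (10.6), p. 54] -/
theorem residue102zero_eq (D j : ℕ) {y : ℝ} (hy : 0 < y) {r : ℝ} (hr : 0 < r) :
    (2 * π * I)⁻¹ * (∮ s in C(0, r),
        ((Pp1 D : ℂ) ^ s - 2 * (Pp2 D : ℂ) ^ s + (Pp3 D : ℂ) ^ s) / (y : ℂ) ^ s *
          (s - betaJ c' D j) / s ^ 2) = 0 := by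
  have h0 : (0 : ℂ) ∈ ball (0 : ℂ) r := mem_ball_self hr
  have hP1 : Ppow (ell D ^ 9) 0.504 = Pp1 D := (bigP_rpow_eq_Ppow D 0.504).symm
  have hP2 : Ppow (ell D ^ 9) 0.502 = Pp2 D := (bigP_rpow_eq_Ppow D 0.502).symm
  have hP3 : Ppow (ell D ^ 9) 0.5 = Pp3 D := (bigP_rpow_eq_Ppow D 0.5).symm
  have key := lemma101_range1 (betaJ c' D j) (Λ := ell D ^ 9) hy h0
  rw [hP1, hP2, hP3] at key
  have hfun : (fun s : ℂ => ((Pp1 D : ℂ) ^ s - 2 * (Pp2 D : ℂ) ^ s + (Pp3 D : ℂ) ^ s) / (y : ℂ) ^ s *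
        (s - betaJ c' D j) / s ^ 2) =
      fun s => texp3 (Real.log (Pp1 D / y)) (Real.log (Pp2 D / y)) (Real.log (Pp3 D / y)) s *
        (s - betaJ c' D j) / s ^ 2 := by
    funext s
    rw [num3_div_eq_texp3 D hy s]
  rw [hfun, key]

end Residues101

/-! ## Z22:§10.u013 under the campaign's `α₁` ruling (`α₁ := α·log T`, `Skeleton.alpha1`)

The manuscript's `α₁` is defined nowhere; the cell's ruling of record (gap row D-G-L4t10-2, skeleton
file `SkeletonAlpha1`) reads `α₁ := α·log T = α𝓛^{1.1}` (`Skeleton.alpha1 D = alpha D · log(bigT D)`).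
`Step10u013` above was typed with the older bank convention `α₁ ↦ α𝓛`, which is the STRONGER claim
(`α𝓛 ≤ α₁` for `D ≥ 3`, `Skeleton.alpha_mul_ell_le_alpha1`) and is false pointwise on the windows
(`f̃(log(ym)/log P)` reaches `≍ log T/log P = 𝓛^{−7.9} ≫ α𝓛 = π𝓛⁻⁸`; being (A)-guarded with a
`χ`-free body it is not refutable in the kernel). The node is therefore re-stated with `alpha1` and
PROVED in that reading; the proof node `Lemma101Proof` keeps its banked antecedent (and holds a
fortiori once `Skeleton.Lemma101 c′` is a theorem of the tree). -/

section Alpha1Reading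

/-- **Z22:§10.u013, reading of record `α₁ := α·log T`** (p. 54, tex L2785): "In the case
`y ∈ (P^{0.5}/T, P^{0.5}] ∪ (P^{0.504}/T, P^{0.504})` and `m < T`, we have `f̃(log(ym)/log P) ≪ α₁`",
with `α₁ = Skeleton.alpha1 D` (the display of `Step10u013` verbatim, `alpha1 D` in place of
`alpha D * ell D`). CLAIM; PROVED below (`step10u013R_holds`, `C = 2000/π`).
[cite: Zhang2022LandauSiegel, §10 p. 54, tex L2785] -/
def Step10u013R : Prop :=
  ∃ C : ℝ, ForAllLarge fun D _ χ => AssumptionA D χ → ∀ y : ℝ,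
    y ∈ Set.Ioc (bigP D ^ (0.5 : ℝ) / bigT D) (bigP D ^ (0.5 : ℝ)) ∪
        Set.Ioo (bigP D ^ (0.504 : ℝ) / bigT D) (bigP D ^ (0.504 : ℝ)) →
      ∀ m : ℕ, 1 ≤ m → (m : ℝ) < bigT D →
        |ftilde (Real.log (y * m) / Real.log (bigP D))| ≤ C * alpha1 D

/-- The banked `α𝓛`-form implies the reading of record (`α𝓛 ≤ α₁` for `D ≥ 3`; the implied
constant is replaced by `max C 0`). [cite: Zhang2022LandauSiegel, §10 p. 54, tex L2785] -/
theorem step10u013R_of_step10u013 (h : Step10u013) : Step10u013R := by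
  obtain ⟨C, D₀, h⟩ := h
  refine ⟨max C 0, max D₀ 3, fun D _ χ hD hq hp => ?_⟩
  intro hA y hy m hm hmT
  have hD₀ : D₀ ≤ D := le_trans (le_max_left _ _) hD
  have hD3 : 3 ≤ D := le_trans (le_max_right _ _) hD
  have h1 := h D χ hD₀ hq hp hA y hy m hm hmT
  have hαℓ : 0 ≤ alpha D * ell D :=
    mul_nonneg (alpha_pos hD3).le (zero_le_one.trans (one_lt_ell hD3).le)
  have hα1 : 0 ≤ alpha1 D := hαℓ.trans (alpha_mul_ell_le_alpha1 hD3)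
  calc |ftilde (Real.log (y * m) / Real.log (bigP D))| ≤ C * (alpha D * ell D) := h1
    _ ≤ max C 0 * (alpha D * ell D) := mul_le_mul_of_nonneg_right (le_max_left _ _) hαℓ
    _ ≤ max C 0 * alpha1 D :=
        mul_le_mul_of_nonneg_left (alpha_mul_ell_le_alpha1 hD3) (le_max_right _ _)

/-- **Z22:§10.u013 HOLDS in the reading of record** (`C = 2000/π`, all `D ≥ 3`, no use of (A)):
on either window, `|log(ym)/log P − a| ≤ log T/log P` with `a = 0.5` resp. `a = 0.504`
(`log y` within `log T` below `a·log P`, `0 ≤ log m < log T`), `f̃(a) = 0`, and `f̃` is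
`2000`-Lipschitz (tree `Lemma101.abs_ftilde_sub_le`); finally `2000·log T/log P = (2000/π)·α₁`
(`α = π/log P`, `α₁ = α log T`). [cite: Zhang2022LandauSiegel, §10 p. 54, tex L2785] -/
theorem step10u013R_holds : Step10u013R := by
  refine ⟨2000 / π, 3, fun D _ χ hD _ _ => ?_⟩
  intro _ y hy m hm hmT
  have hell : 1 < ell D := one_lt_ell hD
  have hP1 : 1 < bigP D := by
    rw [bigP, ← Real.exp_zero]
    exact Real.exp_lt_exp.mpr (by positivity)
  have hP0 : 0 < bigP D := by linarith
  have hL : 0 < Real.log (bigP D) := Real.log_pos hP1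
  have hT0 : 0 < bigT D := Real.exp_pos _
  have hm0 : (0 : ℝ) < m := by exact_mod_cast hm
  have hlogm0 : 0 ≤ Real.log m := Real.log_nonneg (by exact_mod_cast hm)
  have hlogmT : Real.log m < Real.log (bigT D) := Real.log_lt_log hm0 hmT
  -- a zero `a` of `f̃` with `|log(ym) − a·log P| ≤ log T`
  have key : ∃ a : ℝ, ftilde a = 0 ∧
      |Real.log (y * m) - a * Real.log (bigP D)| ≤ Real.log (bigT D) := by
    rcases hy with ⟨hy1, hy2⟩ | ⟨hy1, hy2⟩
    · have hPa : 0 < bigP D ^ (0.5 : ℝ) := Real.rpow_pos_of_pos hP0 _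
      have hy0 : 0 < y := lt_trans (div_pos hPa hT0) hy1
      have e1 : Real.log (y * m) = Real.log y + Real.log m := Real.log_mul hy0.ne' hm0.ne'
      have e2 : Real.log (bigP D ^ (0.5 : ℝ)) = 0.5 * Real.log (bigP D) := Real.log_rpow hP0 _
      have h2 : Real.log y ≤ 0.5 * Real.log (bigP D) := by
        rw [← e2]; exact Real.log_le_log hy0 hy2
      have h1 : 0.5 * Real.log (bigP D) - Real.log (bigT D) < Real.log y := by
        have := Real.log_lt_log (div_pos hPa hT0) hy1
        rwa [Real.log_div hPa.ne' hT0.ne', e2] at this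
      refine ⟨0.5, Lemma101.ftilde_eq_zero_of_le le_rfl, ?_⟩
      rw [e1, abs_le]
      constructor <;> linarith
    · have hPa : 0 < bigP D ^ (0.504 : ℝ) := Real.rpow_pos_of_pos hP0 _
      have hy0 : 0 < y := lt_trans (div_pos hPa hT0) hy1
      have e1 : Real.log (y * m) = Real.log y + Real.log m := Real.log_mul hy0.ne' hm0.ne'
      have e2 : Real.log (bigP D ^ (0.504 : ℝ)) = 0.504 * Real.log (bigP D) := Real.log_rpow hP0 _
      have h2 : Real.log y < 0.504 * Real.log (bigP D) := by
        rw [← e2]; exact Real.log_lt_log hy0 hy2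
      have h1 : 0.504 * Real.log (bigP D) - Real.log (bigT D) < Real.log y := by
        have := Real.log_lt_log (div_pos hPa hT0) hy1
        rwa [Real.log_div hPa.ne' hT0.ne', e2] at this
      refine ⟨0.504, Lemma101.ftilde_eq_zero_of_ge le_rfl, ?_⟩
      rw [e1, abs_le]
      constructor <;> linarith
  obtain ⟨a, ha0, hab⟩ := key
  have hlip := Lemma101.abs_ftilde_sub_le (Real.log (y * m) / Real.log (bigP D)) a
  rw [ha0, sub_zero] at hlip
  have e3 : Real.log (y * m) / Real.log (bigP D) - a =
      (Real.log (y * m) - a * Real.log (bigP D)) / Real.log (bigP D) := by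
    field_simp
  rw [e3, abs_div, abs_of_pos hL] at hlip
  have e4 : 2000 / π * alpha1 D = 2000 * (Real.log (bigT D) / Real.log (bigP D)) := by
    have hπ : (π : ℝ) ≠ 0 := Real.pi_pos.ne'
    rw [alpha1, alpha]
    field_simp
  rw [e4]
  calc |ftilde (Real.log (y * m) / Real.log (bigP D))|
      ≤ 2000 * (|Real.log (y * m) - a * Real.log (bigP D)| / Real.log (bigP D)) := hlip
    _ ≤ 2000 * (Real.log (bigT D) / Real.log (bigP D)) := by gcongr

/-- `Step10u013R` — `_holds` alias of `step10u013R_holds` above under the fact's exact name (appended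
2026-08-28, D-0026 bookkeeping: the proof term is the existing theorem of this file; no statement,
definition or attribute is edited; no new named fact; the ledger's debt table listed the fact
unproved). [cite: Zhang2022LandauSiegel, §10 p. 54, tex L2785] -/
theorem _root_.Literature.NumberTheory.LFunctions.Zhang2022.Typed.Sec10A.Step10u013R_holds :
    Step10u013R :=
  _root_.Literature.NumberTheory.LFunctions.Zhang2022.Typed.Sec10A.step10u013R_holds

end Alpha1Reading

end Literature.NumberTheory.LFunctions.Zhang2022.Typed.Sec10A
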